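import Summits.Langlands.Langlands.Theses.MinimalLevelDescent
import Summits.Langlands.Langlands.Theses.SolvableReachSplit
import Literature.NumberTheory.Automorphic.GLnAdelicStructureProofs
import Literature.NumberTheory.GaloisRepresentations.ResidualGaloisRep
import Literature.NumberTheory.GaloisRepresentations.CrystallineDeformationRing
import Summits.Langlands.Langlands.Theorems.IrreducibilityBySelfDualityIrreducibleOffSectorTransfer
import Literature.NumberTheory.GaloisRepresentations.WeilDeligneOfGaloisUnramifiedProofs
import Literature.NumberTheory.Automorphic.LocalComponentBJUniqueProofs
import Literature.FieldTheory.AlgClosed.PadicAlgClEquivComplex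
import Summits.Langlands.Langlands.Theses.CompatibleFamilySplit

/-!
Part 1/4 of the support module of the decomp-langlands lens-4 nodes g6 `LevelOneNormalForm` + g7 `DyadicCompanion` for
route-Langlands-MinimalLevelDescent rev 3 (crux Z = `MinimalLevelDescent.LevelOneCrystallineDescent`, stmt-Langlands-31277):
the 1239-line candidate `nodes/lens-4-g7-DyadicCompanion.module.lean` (rc 0 · 0 sorry) CUT by topic at the gate's request
(census REPLY 2026-08-30T09:08:07Z: theorem files ≤ 400 lines, statement-only file ≤ 1000, docstring on every decl), SAME namespace
`Summit.Langlands.Langlands.Theorems.LevelOneDyadic` in all four parts so that every kernel theorem keeps its name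
(`LevelOneDyadic.item_31277_of_pieces`, `…dyadicLevelOneCompanion_iff_pieces`, `…_of_langlands`).  0 sorry; axioms standard.

# Part 1 — VOCABULARY (statement-only: `def … : Prop`, no theorem).
W⁺ / Lift_w texts, the lens-4 height frame (level, crystalline, lift-minimal, killable / monodromic / level-one dials, instance
sets, induction hypotheses), the pieces K `ResidualInertiaDescent`, Z `LevelOneCrystallineDescent` (+ record F, U, M₀, frame),
the tower mechanism SD / BC / T⁺, and g7's dyadic vocabulary `CompanionMatch`, C₂ `DyadicLevelOneCompanion`,
E `DyadicCompanionExistence`, I `DyadicIrreducibilityTransfer`, U `DyadicLevelTransfer` — every text byte-identical to the node of record.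
-/

set_option linter.dupNamespace false

namespace Summit.Langlands.Langlands.Theorems.LevelOneDyadic

open scoped NumberField
open Filter IsDedekindDomain Polynomial
open Literature.NumberTheory.GaloisRepresentations Literature.NumberTheory.Automorphic
open Summit.Langlands.Langlands.Theses

/-! # FRAME OF RECORD — the g6 node `nodes/lens-4-g6-LevelOneNormalForm.lean` (sha256 1edd0ba8…302a, cleared STATUS L353),
lines 112–763 VERBATIM: vocabulary, pieces K Z (+ g5 record F U), bridges, pure-logic structure, the tower mechanism of K,
necessity certificates and the ten-binder `closes`.  Nothing below this banner and above the banner `g7` is new. -/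

/-! ## Vocabulary (helper predicates; the filed texts below inline them verbatim — bridges are `Iff.rfl`) -/

/-- W⁺ (item stmt-Langlands-17415, verbatim): irreducible Satake avatars of L-algebraic cuspidal π exist at every (ℓ, ι). -/
def WPlus : Prop := (∀ (K : Type) [Field K] [NumberField K] (n : ℕ) (hcpt : Literature.NumberTheory.Automorphic.isCompact_glFiniteIntegralLevel n K), 0 < n → ∀ (π : Literature.NumberTheory.Automorphic.CuspidalAutomorphicRepData n K hcpt), π.1.IsLAlgebraic → ∀ (ℓ : ℕ) [Fact ℓ.Prime] (ι : PadicAlgCl ℓ ≃+* ℂ), ∃ ρ : Literature.NumberTheory.GaloisRepresentations.FramedGaloisRep K (PadicAlgCl ℓ) n, ρ.toGaloisRep.IsIrreducible ∧ ∀ᶠ v : IsDedekindDomain.HeightOneSpectrum (NumberField.RingOfIntegers K) in cofinite, SatakeFrobCompatibleAt ι π.1 ρ v)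

/-- Lift_w (item stmt-Langlands-24016, verbatim): automorphy lifting from an irreducible automorphic congruent ρ′. -/
def LiftW : Prop := (∀ (K : Type) [Field K] [NumberField K] (n : ℕ) (hcpt : Literature.NumberTheory.Automorphic.isCompact_glFiniteIntegralLevel n K), 0 < n → ∀ (ℓ : ℕ) [Fact ℓ.Prime] (ι : PadicAlgCl ℓ ≃+* ℂ) (ρ : Literature.NumberTheory.GaloisRepresentations.FramedGaloisRep K (PadicAlgCl ℓ) n), ρ.toGaloisRep.IsIrreducible → ((∀ᶠ v : IsDedekindDomain.HeightOneSpectrum (NumberField.RingOfIntegers K) in cofinite, ρ.IsUnramifiedAt v) ∧ ∀ (v : IsDedekindDomain.HeightOneSpectrum (NumberField.RingOfIntegers K)) (hv : ((ℓ : ℕ) : NumberField.RingOfIntegers K) ∈ v.asIdeal), (Literature.NumberTheory.PAdicHodge.fontainePstAdicCompletion v ℓ hv).IsDeRhamFramed (ρ.toLocal v)) → (∃ (π : Literature.NumberTheory.Automorphic.CuspidalAutomorphicRepData n K hcpt) (ρ' : Literature.NumberTheory.GaloisRepresentations.FramedGaloisRep K (PadicAlgCl ℓ) n), π.1.IsLAlgebraic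 ∧ ρ'.toGaloisRep.IsIrreducible ∧ (∀ᶠ v : IsDedekindDomain.HeightOneSpectrum (NumberField.RingOfIntegers K) in cofinite, SatakeFrobCompatibleAt ι π.1 ρ' v) ∧ ∀ᶠ v : IsDedekindDomain.HeightOneSpectrum (NumberField.RingOfIntegers K) in cofinite, ∃ P P' : Polynomial (Valued.v : Valuation (PadicAlgCl ℓ) NNReal).valuationSubring, ρ.HasFrobCharpolyAt v (P.map (Valued.v : Valuation (PadicAlgCl ℓ) NNReal).valuationSubring.subtype) ∧ ρ'.HasFrobCharpolyAt v (P'.map (Valued.v : Valuation (PadicAlgCl ℓ) NNReal).valuationSubring.subtype) ∧ P.map (IsLocalRing.residue (Valued.v : Valuation (PadicAlgCl ℓ) NNReal).valuationSubring) = P'.map (IsLocalRing.residue (Valued.v : Valuation (PadicAlgCl ℓ) NNReal).valuationSubring)) → ∃ π : Literature.NumberTheory.Automorphic.CuspidalAutomorphicRepData n K hcpt, π.1.IsLAlgebraic ∧ ∀ᶠ v : IsDedekindDomain.HeightOneSpectrum (NumberField.RingOfIntegers K) in cofinite, SatakeFrobCompatibleAt ι π.1 ρ v)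

variable {K : Type} [Field K] [NumberField K] {ℓ : ℕ} [Fact ℓ.Prime] {n : ℕ}


/-- Pinned-geometric: a.e. unramified and de Rham above ℓ for Fontaine's pinned datum (Serre_w's hypothesis, verbatim). -/
def IsPinnedGeometric (ρ : FramedGaloisRep K (PadicAlgCl ℓ) n) : Prop := ((∀ᶠ v : IsDedekindDomain.HeightOneSpectrum (NumberField.RingOfIntegers K) in cofinite, ρ.IsUnramifiedAt v) ∧ ∀ (v : IsDedekindDomain.HeightOneSpectrum (NumberField.RingOfIntegers K)) (hv : ((ℓ : ℕ) : NumberField.RingOfIntegers K) ∈ v.asIdeal), (Literature.NumberTheory.PAdicHodge.fontainePstAdicCompletion v ℓ hv).IsDeRhamFramed (ρ.toLocal v))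

/-- Serre_w's conclusion for one ρ (verbatim): an L-algebraic cuspidal π whose L-normalised Satake polynomials are congruent
mod 𝔪(ℤ̄_ℓ) to the integral Frobenius polynomials of ρ at almost all places. -/
def IsResiduallyAutomorphic (hcpt : isCompact_glFiniteIntegralLevel n K) (ι : PadicAlgCl ℓ ≃+* ℂ)
    (ρ : FramedGaloisRep K (PadicAlgCl ℓ) n) : Prop := ∃ π : Literature.NumberTheory.Automorphic.CuspidalAutomorphicRepData n K hcpt, π.1.IsLAlgebraic ∧ ∀ᶠ v : IsDedekindDomain.HeightOneSpectrum (NumberField.RingOfIntegers K) in cofinite, ρ.IsUnramifiedAt v ∧ (∃ α : Multiset ℂ, π.1.HasSatakeParamAt v α) ∧ ∀ α : Multiset ℂ, π.1.HasSatakeParamAt v α → ∃ P Q : Polynomial (Valued.v : Valuation (PadicAlgCl ℓ) NNReal).valuationSubring, ρ.HasFrobCharpolyAt v (P.map (Valued.v : Valuation (PadicAlgCl ℓ) NNReal).valuationSubring.subtype) ∧ Literature.NumberTheory.Automorphic.arithFrobPolyOfSatake ι v.residueCard 1 α = Q.map (Valued.v : Valuation (PadicAlgCl ℓ) NNReal).valuationSubring.subtype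 ∧ P.map (IsLocalRing.residue (Valued.v : Valuation (PadicAlgCl ℓ) NNReal).valuationSubring) = Q.map (IsLocalRing.residue (Valued.v : Valuation (PadicAlgCl ℓ) NNReal).valuationSubring)

/-- Level ≤ k: unramified at every v ∤ ℓ outside at most k places (the height's first coordinate, g3). -/
def HasLevelAtMost (ρ : FramedGaloisRep K (PadicAlgCl ℓ) n) (k : ℕ) : Prop :=
  ∃ S : Finset (HeightOneSpectrum (𝓞 K)), S.card ≤ k ∧ ∀ v ∉ S, ((ℓ : ℕ) : 𝓞 K) ∉ v.asIdeal → ρ.IsUnramifiedAt v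

/-- Crystalline above ℓ (Fontaine's pinned datum), at every v ∣ ℓ (g4's first coordinate). -/
def IsCrystallineAbove (ρ : FramedGaloisRep K (PadicAlgCl ℓ) n) : Prop :=
  ∀ (v : HeightOneSpectrum (𝓞 K)) (hv : ((ℓ : ℕ) : 𝓞 K) ∈ v.asIdeal),
    (Literature.NumberTheory.PAdicHodge.fontainePstAdicCompletion v ℓ hv).IsCrystallineFramed (ρ.toLocal v)

/-- A residual representation τ : Γ_K → GL_n(ℤ̄_ℓ/𝔪) is unramified at w. -/
def ResidualUnramifiedAt (τ : Field.absoluteGaloisGroup K →* GL (Fin n) (padicAlgClResidueField ℓ))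
    (w : HeightOneSpectrum (𝓞 K)) : Prop :=
  ∀ 𝔓 ∈ w.primesAbove, ∀ σ ∈ 𝔓.inertia (Field.absoluteGaloisGroup K), τ σ = 1

/-- ρ is LIFT-MINIMAL (g4's second coordinate): at every w ∤ ℓ where ρ ramifies, every semisimplified reduction ramifies too. -/
def IsLiftMinimal (ρ : FramedGaloisRep K (PadicAlgCl ℓ) n) : Prop :=
  ∀ w : HeightOneSpectrum (𝓞 K), ((ℓ : ℕ) : 𝓞 K) ∉ w.asIdeal → ¬ ρ.IsUnramifiedAt w →
    ∀ τ : Field.absoluteGaloisGroup K →* GL (Fin n) (padicAlgClResidueField ℓ),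
      ρ.IsResidualRepOf (RingHom.id (padicAlgClResidueField ℓ)) τ → ¬ ResidualUnramifiedAt τ w

/-- NEW COORDINATE (g5) — ρ has FINITE INERTIA IMAGE at w: every inertia group above w has finite image under ρ
(ρ is potentially unramified at w: some finite extension of K_w kills the ramification). -/
def HasFiniteInertiaImageAt (ρ : FramedGaloisRep K (PadicAlgCl ℓ) n) (w : HeightOneSpectrum (𝓞 K)) : Prop :=
  ∀ 𝔓 ∈ w.primesAbove, (ρ '' (𝔓.inertia (Field.absoluteGaloisGroup K) : Set (Field.absoluteGaloisGroup K))).Finite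

/-- ρ has a KILLABLE PLACE: a place w ∤ ℓ where ρ ramifies with finite inertia image. -/
def HasKillablePlace (ρ : FramedGaloisRep K (PadicAlgCl ℓ) n) : Prop :=
  ∃ w : HeightOneSpectrum (𝓞 K), ((ℓ : ℕ) : 𝓞 K) ∉ w.asIdeal ∧ ¬ ρ.IsUnramifiedAt w ∧ HasFiniteInertiaImageAt ρ w

/-- ρ is MONODROMIC: it ramifies at some w ∤ ℓ, and at EVERY such ramified w the inertia image is infinite
(after any finite base change a non-trivial unipotent monodromy survives: no solvable extension kills a bad place). -/
def IsMonodromic (ρ : FramedGaloisRep K (PadicAlgCl ℓ) n) : Prop :=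
  (∃ w : HeightOneSpectrum (𝓞 K), ((ℓ : ℕ) : 𝓞 K) ∉ w.asIdeal ∧ ¬ ρ.IsUnramifiedAt w) ∧
    ∀ w : HeightOneSpectrum (𝓞 K), ((ℓ : ℕ) : 𝓞 K) ∉ w.asIdeal → ¬ ρ.IsUnramifiedAt w → ¬ HasFiniteInertiaImageAt ρ w

/-- ρ has LEVEL ONE: unramified at every place not above ℓ. -/
def IsUnramifiedAwayFrom (ρ : FramedGaloisRep K (PadicAlgCl ℓ) n) : Prop :=
  ∀ w : HeightOneSpectrum (𝓞 K), ((ℓ : ℕ) : 𝓞 K) ∉ w.asIdeal → ρ.IsUnramifiedAt w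

/-- Serre_w BELOW HEIGHT (k, ℓ) (g3's sublevel set): every irreducible pinned-geometric ℓ-adic ρ of level ≤ k, all K, all n. -/
def SerreBelow (k ℓ : ℕ) [Fact ℓ.Prime] : Prop :=
  ∀ (K : Type) [Field K] [NumberField K] (n : ℕ) (hcpt : isCompact_glFiniteIntegralLevel n K), 0 < n →
    ∀ (ι : PadicAlgCl ℓ ≃+* ℂ) (ρ : FramedGaloisRep K (PadicAlgCl ℓ) n), ρ.toGaloisRep.IsIrreducible →
      IsPinnedGeometric ρ → HasLevelAtMost ρ k → IsResiduallyAutomorphic hcpt ι ρ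

/-- The induction hypothesis of D at height (k, ℓ): Serre_w below every lexicographically smaller height. -/
def IHBelow (k ℓ : ℕ) : Prop :=
  ∀ (k' ℓ' : ℕ) [Fact ℓ'.Prime], (k' < k ∨ (k' = k ∧ ℓ' < ℓ)) → SerreBelow k' ℓ'

/-- M's instance set at height (k, ℓ) (g4): the crystalline-above-ℓ, lift-minimal ρ of level ≤ k. -/
def MinimalBelow (k ℓ : ℕ) [Fact ℓ.Prime] : Prop :=
  ∀ (K : Type) [Field K] [NumberField K] (n : ℕ) (hcpt : isCompact_glFiniteIntegralLevel n K), 0 < n →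
    ∀ (ι : PadicAlgCl ℓ ≃+* ℂ) (ρ : FramedGaloisRep K (PadicAlgCl ℓ) n), ρ.toGaloisRep.IsIrreducible →
      IsPinnedGeometric ρ → IsCrystallineAbove ρ → HasLevelAtMost ρ k → IsLiftMinimal ρ →
        IsResiduallyAutomorphic hcpt ι ρ

/-- F's instance set at height (k, ℓ): M's ρ WITH A KILLABLE PLACE. -/
def KillableBelow (k ℓ : ℕ) [Fact ℓ.Prime] : Prop :=
  ∀ (K : Type) [Field K] [NumberField K] (n : ℕ) (hcpt : isCompact_glFiniteIntegralLevel n K), 0 < n →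
    ∀ (ι : PadicAlgCl ℓ ≃+* ℂ) (ρ : FramedGaloisRep K (PadicAlgCl ℓ) n), ρ.toGaloisRep.IsIrreducible →
      IsPinnedGeometric ρ → IsCrystallineAbove ρ → HasLevelAtMost ρ k → IsLiftMinimal ρ → HasKillablePlace ρ →
        IsResiduallyAutomorphic hcpt ι ρ

/-- U's instance set at height (k, ℓ): M's MONODROMIC ρ. -/
def MonodromicBelow (k ℓ : ℕ) [Fact ℓ.Prime] : Prop :=
  ∀ (K : Type) [Field K] [NumberField K] (n : ℕ) (hcpt : isCompact_glFiniteIntegralLevel n K), 0 < n →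
    ∀ (ι : PadicAlgCl ℓ ≃+* ℂ) (ρ : FramedGaloisRep K (PadicAlgCl ℓ) n), ρ.toGaloisRep.IsIrreducible →
      IsPinnedGeometric ρ → IsCrystallineAbove ρ → HasLevelAtMost ρ k → IsLiftMinimal ρ → IsMonodromic ρ →
        IsResiduallyAutomorphic hcpt ι ρ

/-- Z's instance set at the prime ℓ: the crystalline-above-ℓ ρ of LEVEL ONE (any K, any n). -/
def LevelOneBelow (ℓ : ℕ) [Fact ℓ.Prime] : Prop :=
  ∀ (K : Type) [Field K] [NumberField K] (n : ℕ) (hcpt : isCompact_glFiniteIntegralLevel n K), 0 < n →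
    ∀ (ι : PadicAlgCl ℓ ≃+* ℂ) (ρ : FramedGaloisRep K (PadicAlgCl ℓ) n), ρ.toGaloisRep.IsIrreducible →
      IsPinnedGeometric ρ → IsCrystallineAbove ρ → IsUnramifiedAwayFrom ρ → IsResiduallyAutomorphic hcpt ι ρ

/-- Z's induction hypothesis at the prime ℓ: Serre_w for the LEVEL-ONE ρ′ at every prime ℓ′ < ℓ (any K′, any n′;
no crystalline condition) — KW's induction on the prime, started at ℓ′ = 2 by the route's B₂. -/
def LevelOneIH (ℓ : ℕ) : Prop :=
  ∀ (ℓ' : ℕ) [Fact ℓ'.Prime], ℓ' < ℓ →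
    ∀ (K' : Type) [Field K'] [NumberField K'] (n' : ℕ) (hcpt' : isCompact_glFiniteIntegralLevel n' K'), 0 < n' →
      ∀ (ι' : PadicAlgCl ℓ' ≃+* ℂ) (ρ' : FramedGaloisRep K' (PadicAlgCl ℓ') n'), ρ'.toGaloisRep.IsIrreducible →
        IsPinnedGeometric ρ' → IsUnramifiedAwayFrom ρ' → IsResiduallyAutomorphic hcpt' ι' ρ'


/-- (g4, verbatim) ρ is NON-MINIMAL AT w ∤ ℓ: ρ ramifies at w but some witnessed semisimplified reduction τ of ρ does not. -/
def IsNonMinimalAt (ρ : FramedGaloisRep K (PadicAlgCl ℓ) n) (w : HeightOneSpectrum (𝓞 K)) : Prop :=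
  ((ℓ : ℕ) : 𝓞 K) ∉ w.asIdeal ∧ ¬ ρ.IsUnramifiedAt w ∧
    ∃ τ : Field.absoluteGaloisGroup K →* GL (Fin n) (padicAlgClResidueField ℓ),
      ρ.IsResidualRepOf (RingHom.id (padicAlgClResidueField ℓ)) τ ∧ ResidualUnramifiedAt τ w

/-- (g4, verbatim) Serre_w at height (k, ℓ) for the CRYSTALLINE-ABOVE-ℓ ρ only (W's hypothesis class). -/
def CrysBelow (k ℓ : ℕ) [Fact ℓ.Prime] : Prop :=
  ∀ (K : Type) [Field K] [NumberField K] (n : ℕ) (hcpt : isCompact_glFiniteIntegralLevel n K), 0 < n →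
    ∀ (ι : PadicAlgCl ℓ ≃+* ℂ) (ρ : FramedGaloisRep K (PadicAlgCl ℓ) n), ρ.toGaloisRep.IsIrreducible →
      IsPinnedGeometric ρ → IsCrystallineAbove ρ → HasLevelAtMost ρ k → IsResiduallyAutomorphic hcpt ι ρ

/-- (g4, verbatim) L's instance set at height (k, ℓ) = THE LEVEL-MOVE CLASS: crystalline-above-ℓ ρ of level ≤ k that are
NON-MINIMAL at some w ∤ ℓ.  `MinimalLevelDescent.LevelMove` (item stmt-Langlands-28624) concludes Serre_w exactly on it. -/
def NonMinimalBelow (k ℓ : ℕ) [Fact ℓ.Prime] : Prop :=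
  ∀ (K : Type) [Field K] [NumberField K] (n : ℕ) (hcpt : isCompact_glFiniteIntegralLevel n K), 0 < n →
    ∀ (ι : PadicAlgCl ℓ ≃+* ℂ) (ρ : FramedGaloisRep K (PadicAlgCl ℓ) n), ρ.toGaloisRep.IsIrreducible →
      IsPinnedGeometric ρ → IsCrystallineAbove ρ → HasLevelAtMost ρ k → (∃ w, IsNonMinimalAt ρ w) →
        IsResiduallyAutomorphic hcpt ι ρ

/-- NEW DIAL (g6) — ρ HAS A RAMIFIED PLACE AWAY FROM ℓ (= ¬ level one; = killable ∨ monodromic, `hasRamifiedPlace_iff_killable_or_monodromic`). -/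
def HasRamifiedPlace (ρ : FramedGaloisRep K (PadicAlgCl ℓ) n) : Prop :=
  ∃ w : HeightOneSpectrum (𝓞 K), ((ℓ : ℕ) : 𝓞 K) ∉ w.asIdeal ∧ ¬ ρ.IsUnramifiedAt w

/-- K's instance set at height (k, ℓ): M's ρ (crystalline above ℓ, level ≤ k, lift-minimal) WITH A RAMIFIED PLACE AWAY FROM ℓ
(= g5's F-class ∪ U-class: killable or monodromic). -/
def RamifiedMinimalBelow (k ℓ : ℕ) [Fact ℓ.Prime] : Prop :=
  ∀ (K : Type) [Field K] [NumberField K] (n : ℕ) (hcpt : isCompact_glFiniteIntegralLevel n K), 0 < n →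
    ∀ (ι : PadicAlgCl ℓ ≃+* ℂ) (ρ : FramedGaloisRep K (PadicAlgCl ℓ) n), ρ.toGaloisRep.IsIrreducible →
      IsPinnedGeometric ρ → IsCrystallineAbove ρ → HasLevelAtMost ρ k → IsLiftMinimal ρ → HasRamifiedPlace ρ →
        IsResiduallyAutomorphic hcpt ι ρ

/-! ## The pieces (one-line self-contained Props over tree declarations = the texts of `texts.json`) -/

/-- [crux · WEAKER than M · ATTACKABLE NOW · PRINT modulo named facts + one elementary tower; certified reduction
`residualInertiaDescent_of_tower` below] K — RESIDUAL-INERTIA DESCENT (transfer form).  Given W⁺, Lift_w, a height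
(k, ℓ) ≠ (0, 2), D's induction hypothesis AND level-move automorphy at the SAME height (k, ℓ) over every number field
(= the conclusion class `NonMinimalBelow k ℓ` of the sibling L = `MinimalLevelDescent.LevelMove`, inlined), Serre_w holds for
every irreducible pinned-geometric ℓ-adic ρ that is crystalline above ℓ, of level ≤ k, lift-minimal, and RAMIFIED AT SOME w ∤ ℓ
(killable or monodromic alike).  Mechanism: kill the RESIDUAL inertia at w — always finite — by a Grunwald–Wang tower of cyclic
prime-degree steps; over the top field L either w is dead (level ≤ k − 1: D's IH over L) or ρ|Γ_L is ramified at w′ with an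
unramified reduction, i.e. NON-MINIMAL at w′: the level-move class at the same height, over L; then Lift_w + W⁺ over L, soluble
base change up the Galois closure, soluble descent (item stmt-Langlands-29341) down to K. -/
def ResidualInertiaDescent : Prop :=
  (∀ (K : Type) [Field K] [NumberField K] (n : ℕ) (hcpt : Literature.NumberTheory.Automorphic.isCompact_glFiniteIntegralLevel n K), 0 < n → ∀ (π : Literature.NumberTheory.Automorphic.CuspidalAutomorphicRepData n K hcpt), π.1.IsLAlgebraic → ∀ (ℓ : ℕ) [Fact ℓ.Prime] (ι : PadicAlgCl ℓ ≃+* ℂ), ∃ ρ : Literature.NumberTheory.GaloisRepresentations.FramedGaloisRep K (PadicAlgCl ℓ) n, ρ.toGaloisRep.IsIrreducible ∧ ∀ᶠ v : IsDedekindDomain.HeightOneSpectrum (NumberField.RingOfIntegers K) in cofinite, SatakeFrobCompatibleAt ι π.1 ρ v) → (∀ (K : Type) [Field K] [NumberField K] (n : ℕ) (hcpt : Literature.NumberTheory.Automorphic.isCompact_glFiniteIntegralLevel n K), 0 < n → ∀ (ℓ : ℕ) [Fact ℓ.Prime] (ι : PadicAlgCl ℓ ≃+* ℂ) (ρ : Literature.NumberTheory.GaloisRepresentations.FramedGaloisRep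 K (PadicAlgCl ℓ) n), ρ.toGaloisRep.IsIrreducible → ((∀ᶠ v : IsDedekindDomain.HeightOneSpectrum (NumberField.RingOfIntegers K) in cofinite, ρ.IsUnramifiedAt v) ∧ ∀ (v : IsDedekindDomain.HeightOneSpectrum (NumberField.RingOfIntegers K)) (hv : ((ℓ : ℕ) : NumberField.RingOfIntegers K) ∈ v.asIdeal), (Literature.NumberTheory.PAdicHodge.fontainePstAdicCompletion v ℓ hv).IsDeRhamFramed (ρ.toLocal v)) → (∃ (π : Literature.NumberTheory.Automorphic.CuspidalAutomorphicRepData n K hcpt) (ρ' : Literature.NumberTheory.GaloisRepresentations.FramedGaloisRep K (PadicAlgCl ℓ) n), π.1.IsLAlgebraic ∧ ρ'.toGaloisRep.IsIrreducible ∧ (∀ᶠ v : IsDedekindDomain.HeightOneSpectrum (NumberField.RingOfIntegers K) in cofinite, SatakeFrobCompatibleAt ι π.1 ρ' v) ∧ ∀ᶠ v : IsDedekindDomain.HeightOneSpectrum (NumberField.RingOfIntegers K) in cofinite, ∃ P P' : Polynomial (Valued.v : Valuation (PadicAlgCl ℓ) NNReal).valuationSubring, ρ.HasFrobCharpolyAt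 v (P.map (Valued.v : Valuation (PadicAlgCl ℓ) NNReal).valuationSubring.subtype) ∧ ρ'.HasFrobCharpolyAt v (P'.map (Valued.v : Valuation (PadicAlgCl ℓ) NNReal).valuationSubring.subtype) ∧ P.map (IsLocalRing.residue (Valued.v : Valuation (PadicAlgCl ℓ) NNReal).valuationSubring) = P'.map (IsLocalRing.residue (Valued.v : Valuation (PadicAlgCl ℓ) NNReal).valuationSubring)) → ∃ π : Literature.NumberTheory.Automorphic.CuspidalAutomorphicRepData n K hcpt, π.1.IsLAlgebraic ∧ ∀ᶠ v : IsDedekindDomain.HeightOneSpectrum (NumberField.RingOfIntegers K) in cofinite, SatakeFrobCompatibleAt ι π.1 ρ v) → ∀ (k ℓ : ℕ) [Fact ℓ.Prime], ¬ (k = 0 ∧ ℓ = 2) → (∀ (k' ℓ' : ℕ) [Fact ℓ'.Prime], (k' < k ∨ (k' = k ∧ ℓ' < ℓ)) → ∀ (K' : Type) [Field K'] [NumberField K'] (n' : ℕ) (hcpt' : Literature.NumberTheory.Automorphic.isCompact_glFiniteIntegralLevel n' K'), 0 < n' → ∀ (ι' : PadicAlgCl ℓ' ≃+* ℂ) (ρ'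 : Literature.NumberTheory.GaloisRepresentations.FramedGaloisRep K' (PadicAlgCl ℓ') n'), ρ'.toGaloisRep.IsIrreducible → ((∀ᶠ v : IsDedekindDomain.HeightOneSpectrum (NumberField.RingOfIntegers K') in cofinite, ρ'.IsUnramifiedAt v) ∧ ∀ (v : IsDedekindDomain.HeightOneSpectrum (NumberField.RingOfIntegers K')) (hv : ((ℓ' : ℕ) : NumberField.RingOfIntegers K') ∈ v.asIdeal), (Literature.NumberTheory.PAdicHodge.fontainePstAdicCompletion v ℓ' hv).IsDeRhamFramed (ρ'.toLocal v)) → (∃ S : Finset (IsDedekindDomain.HeightOneSpectrum (NumberField.RingOfIntegers K')), S.card ≤ k' ∧ ∀ v ∉ S, ((ℓ' : ℕ) : NumberField.RingOfIntegers K') ∉ v.asIdeal → ρ'.IsUnramifiedAt v) → ∃ π : Literature.NumberTheory.Automorphic.CuspidalAutomorphicRepData n' K' hcpt', π.1.IsLAlgebraic ∧ ∀ᶠ v : IsDedekindDomain.HeightOneSpectrum (NumberField.RingOfIntegers K') in cofinite, ρ'.IsUnramifiedAt v ∧ (∃ α : Multiset ℂ, π.1.HasSatakeParamAt v α) ∧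 ∀ α : Multiset ℂ, π.1.HasSatakeParamAt v α → ∃ P Q : Polynomial (Valued.v : Valuation (PadicAlgCl ℓ') NNReal).valuationSubring, ρ'.HasFrobCharpolyAt v (P.map (Valued.v : Valuation (PadicAlgCl ℓ') NNReal).valuationSubring.subtype) ∧ Literature.NumberTheory.Automorphic.arithFrobPolyOfSatake ι' v.residueCard 1 α = Q.map (Valued.v : Valuation (PadicAlgCl ℓ') NNReal).valuationSubring.subtype ∧ P.map (IsLocalRing.residue (Valued.v : Valuation (PadicAlgCl ℓ') NNReal).valuationSubring) = Q.map (IsLocalRing.residue (Valued.v : Valuation (PadicAlgCl ℓ') NNReal).valuationSubring)) → (∀ (K : Type) [Field K] [NumberField K] (n : ℕ) (hcpt : Literature.NumberTheory.Automorphic.isCompact_glFiniteIntegralLevel n K), 0 < n → ∀ (ι : PadicAlgCl ℓ ≃+* ℂ) (ρ : Literature.NumberTheory.GaloisRepresentations.FramedGaloisRep K (PadicAlgCl ℓ) n), ρ.toGaloisRep.IsIrreducible → ((∀ᶠ v : IsDedekindDomain.HeightOneSpectrum (NumberField.RingOfIntegers K) in cofinite, ρ.IsUnramifiedAt v) ∧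 ∀ (v : IsDedekindDomain.HeightOneSpectrum (NumberField.RingOfIntegers K)) (hv : ((ℓ : ℕ) : NumberField.RingOfIntegers K) ∈ v.asIdeal), (Literature.NumberTheory.PAdicHodge.fontainePstAdicCompletion v ℓ hv).IsDeRhamFramed (ρ.toLocal v)) → (∀ (v : IsDedekindDomain.HeightOneSpectrum (NumberField.RingOfIntegers K)) (hv : ((ℓ : ℕ) : NumberField.RingOfIntegers K) ∈ v.asIdeal), (Literature.NumberTheory.PAdicHodge.fontainePstAdicCompletion v ℓ hv).IsCrystallineFramed (ρ.toLocal v)) → (∃ S : Finset (IsDedekindDomain.HeightOneSpectrum (NumberField.RingOfIntegers K)), S.card ≤ k ∧ ∀ v ∉ S, ((ℓ : ℕ) : NumberField.RingOfIntegers K) ∉ v.asIdeal → ρ.IsUnramifiedAt v) → (∃ w : IsDedekindDomain.HeightOneSpectrum (NumberField.RingOfIntegers K), ((ℓ : ℕ) : NumberField.RingOfIntegers K) ∉ w.asIdeal ∧ ¬ ρ.IsUnramifiedAt w ∧ ∃ τ : Field.absoluteGaloisGroup K →* Matrix.GeneralLinearGroup (Fin n) (Literature.NumberTheory.GaloisRepresentations.padicAlgClResidueField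 ℓ), ρ.IsResidualRepOf (RingHom.id (Literature.NumberTheory.GaloisRepresentations.padicAlgClResidueField ℓ)) τ ∧ ∀ 𝔓 ∈ w.primesAbove, ∀ σ ∈ 𝔓.inertia (Field.absoluteGaloisGroup K), τ σ = 1) → ∃ π : Literature.NumberTheory.Automorphic.CuspidalAutomorphicRepData n K hcpt, π.1.IsLAlgebraic ∧ ∀ᶠ v : IsDedekindDomain.HeightOneSpectrum (NumberField.RingOfIntegers K) in cofinite, ρ.IsUnramifiedAt v ∧ (∃ α : Multiset ℂ, π.1.HasSatakeParamAt v α) ∧ ∀ α : Multiset ℂ, π.1.HasSatakeParamAt v α → ∃ P Q : Polynomial (Valued.v : Valuation (PadicAlgCl ℓ) NNReal).valuationSubring, ρ.HasFrobCharpolyAt v (P.map (Valued.v : Valuation (PadicAlgCl ℓ) NNReal).valuationSubring.subtype) ∧ Literature.NumberTheory.Automorphic.arithFrobPolyOfSatake ι v.residueCard 1 α = Q.map (Valued.v : Valuation (PadicAlgCl ℓ) NNReal).valuationSubring.subtype ∧ P.map (IsLocalRing.residue (Valued.v : Valuation (PadicAlgCl ℓ) NNReal).valuationSubring) = Q.map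 (IsLocalRing.residue (Valued.v : Valuation (PadicAlgCl ℓ) NNReal).valuationSubring)) → ∀ (K : Type) [Field K] [NumberField K] (n : ℕ) (hcpt : Literature.NumberTheory.Automorphic.isCompact_glFiniteIntegralLevel n K), 0 < n → ∀ (ι : PadicAlgCl ℓ ≃+* ℂ) (ρ : Literature.NumberTheory.GaloisRepresentations.FramedGaloisRep K (PadicAlgCl ℓ) n), ρ.toGaloisRep.IsIrreducible → ((∀ᶠ v : IsDedekindDomain.HeightOneSpectrum (NumberField.RingOfIntegers K) in cofinite, ρ.IsUnramifiedAt v) ∧ ∀ (v : IsDedekindDomain.HeightOneSpectrum (NumberField.RingOfIntegers K)) (hv : ((ℓ : ℕ) : NumberField.RingOfIntegers K) ∈ v.asIdeal), (Literature.NumberTheory.PAdicHodge.fontainePstAdicCompletion v ℓ hv).IsDeRhamFramed (ρ.toLocal v)) → (∀ (v : IsDedekindDomain.HeightOneSpectrum (NumberField.RingOfIntegers K)) (hv : ((ℓ : ℕ) : NumberField.RingOfIntegers K) ∈ v.asIdeal), (Literature.NumberTheory.PAdicHodge.fontainePstAdicCompletion v ℓ hv).IsCrystallineFramed (ρ.toLocal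 v)) → (∃ S : Finset (IsDedekindDomain.HeightOneSpectrum (NumberField.RingOfIntegers K)), S.card ≤ k ∧ ∀ v ∉ S, ((ℓ : ℕ) : NumberField.RingOfIntegers K) ∉ v.asIdeal → ρ.IsUnramifiedAt v) → (∀ w : IsDedekindDomain.HeightOneSpectrum (NumberField.RingOfIntegers K), ((ℓ : ℕ) : NumberField.RingOfIntegers K) ∉ w.asIdeal → ¬ ρ.IsUnramifiedAt w → ∀ τ : Field.absoluteGaloisGroup K →* Matrix.GeneralLinearGroup (Fin n) (Literature.NumberTheory.GaloisRepresentations.padicAlgClResidueField ℓ), ρ.IsResidualRepOf (RingHom.id (Literature.NumberTheory.GaloisRepresentations.padicAlgClResidueField ℓ)) τ → ¬ (∀ 𝔓 ∈ w.primesAbove, ∀ σ ∈ 𝔓.inertia (Field.absoluteGaloisGroup K), τ σ = 1)) → (∃ w : IsDedekindDomain.HeightOneSpectrum (NumberField.RingOfIntegers K), ((ℓ : ℕ) : NumberField.RingOfIntegers K) ∉ w.asIdeal ∧ ¬ ρ.IsUnramifiedAt w) → ∃ π : Literature.NumberTheory.Automorphic.CuspidalAutomorphicRepData n K hcpt, π.1.IsLAlgebraic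 ∧ ∀ᶠ v : IsDedekindDomain.HeightOneSpectrum (NumberField.RingOfIntegers K) in cofinite, ρ.IsUnramifiedAt v ∧ (∃ α : Multiset ℂ, π.1.HasSatakeParamAt v α) ∧ ∀ α : Multiset ℂ, π.1.HasSatakeParamAt v α → ∃ P Q : Polynomial (Valued.v : Valuation (PadicAlgCl ℓ) NNReal).valuationSubring, ρ.HasFrobCharpolyAt v (P.map (Valued.v : Valuation (PadicAlgCl ℓ) NNReal).valuationSubring.subtype) ∧ Literature.NumberTheory.Automorphic.arithFrobPolyOfSatake ι v.residueCard 1 α = Q.map (Valued.v : Valuation (PadicAlgCl ℓ) NNReal).valuationSubring.subtype ∧ P.map (IsLocalRing.residue (Valued.v : Valuation (PadicAlgCl ℓ) NNReal).valuationSubring) = Q.map (IsLocalRing.residue (Valued.v : Valuation (PadicAlgCl ℓ) NNReal).valuationSubring)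

/-- [crux · WEAKER than M · DECLARED RESIDUAL of the lineage after g6 · RESIDUAL-GRADE · INSTRUMENTABLE (void theorems)]
Z — LEVEL-ONE CRYSTALLINE DESCENT (lens-4 g5's piece, byte-identical): given W⁺ and Lift_w, for every ODD prime ℓ, if Serre_w
holds for the level-one ρ′ at every prime ℓ′ < ℓ (all K′, n′), then every irreducible pinned-geometric ℓ-adic ρ (any K, n)
crystalline above ℓ and unramified away from ℓ is residually automorphic.  THE NORMAL FORM OF THE MINIMAL COUNTEREXAMPLE. -/
def LevelOneCrystallineDescent : Prop :=
  (∀ (K : Type) [Field K] [NumberField K] (n : ℕ) (hcpt : Literature.NumberTheory.Automorphic.isCompact_glFiniteIntegralLevel n K), 0 < n → ∀ (π : Literature.NumberTheory.Automorphic.CuspidalAutomorphicRepData n K hcpt), π.1.IsLAlgebraic → ∀ (ℓ : ℕ) [Fact ℓ.Prime] (ι : PadicAlgCl ℓ ≃+* ℂ), ∃ ρ : Literature.NumberTheory.GaloisRepresentations.FramedGaloisRep K (PadicAlgCl ℓ) n, ρ.toGaloisRep.IsIrreducible ∧ ∀ᶠ v : IsDedekindDomain.HeightOneSpectrum (NumberField.RingOfIntegers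 K) in cofinite, SatakeFrobCompatibleAt ι π.1 ρ v) → (∀ (K : Type) [Field K] [NumberField K] (n : ℕ) (hcpt : Literature.NumberTheory.Automorphic.isCompact_glFiniteIntegralLevel n K), 0 < n → ∀ (ℓ : ℕ) [Fact ℓ.Prime] (ι : PadicAlgCl ℓ ≃+* ℂ) (ρ : Literature.NumberTheory.GaloisRepresentations.FramedGaloisRep K (PadicAlgCl ℓ) n), ρ.toGaloisRep.IsIrreducible → ((∀ᶠ v : IsDedekindDomain.HeightOneSpectrum (NumberField.RingOfIntegers K) in cofinite, ρ.IsUnramifiedAt v) ∧ ∀ (v : IsDedekindDomain.HeightOneSpectrum (NumberField.RingOfIntegers K)) (hv : ((ℓ : ℕ) : NumberField.RingOfIntegers K) ∈ v.asIdeal), (Literature.NumberTheory.PAdicHodge.fontainePstAdicCompletion v ℓ hv).IsDeRhamFramed (ρ.toLocal v)) → (∃ (π : Literature.NumberTheory.Automorphic.CuspidalAutomorphicRepData n K hcpt) (ρ' : Literature.NumberTheory.GaloisRepresentations.FramedGaloisRep K (PadicAlgCl ℓ) n), π.1.IsLAlgebraic ∧ ρ'.toGaloisRep.IsIrreducible ∧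 (∀ᶠ v : IsDedekindDomain.HeightOneSpectrum (NumberField.RingOfIntegers K) in cofinite, SatakeFrobCompatibleAt ι π.1 ρ' v) ∧ ∀ᶠ v : IsDedekindDomain.HeightOneSpectrum (NumberField.RingOfIntegers K) in cofinite, ∃ P P' : Polynomial (Valued.v : Valuation (PadicAlgCl ℓ) NNReal).valuationSubring, ρ.HasFrobCharpolyAt v (P.map (Valued.v : Valuation (PadicAlgCl ℓ) NNReal).valuationSubring.subtype) ∧ ρ'.HasFrobCharpolyAt v (P'.map (Valued.v : Valuation (PadicAlgCl ℓ) NNReal).valuationSubring.subtype) ∧ P.map (IsLocalRing.residue (Valued.v : Valuation (PadicAlgCl ℓ) NNReal).valuationSubring) = P'.map (IsLocalRing.residue (Valued.v : Valuation (PadicAlgCl ℓ) NNReal).valuationSubring)) → ∃ π : Literature.NumberTheory.Automorphic.CuspidalAutomorphicRepData n K hcpt, π.1.IsLAlgebraic ∧ ∀ᶠ v : IsDedekindDomain.HeightOneSpectrum (NumberField.RingOfIntegers K) in cofinite, SatakeFrobCompatibleAt ι π.1 ρ v) → ∀ (ℓ : ℕ) [Fact ℓ.Prime], ℓ ≠ 2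 → (∀ (ℓ' : ℕ) [Fact ℓ'.Prime], ℓ' < ℓ → ∀ (K' : Type) [Field K'] [NumberField K'] (n' : ℕ) (hcpt' : Literature.NumberTheory.Automorphic.isCompact_glFiniteIntegralLevel n' K'), 0 < n' → ∀ (ι' : PadicAlgCl ℓ' ≃+* ℂ) (ρ' : Literature.NumberTheory.GaloisRepresentations.FramedGaloisRep K' (PadicAlgCl ℓ') n'), ρ'.toGaloisRep.IsIrreducible → ((∀ᶠ v : IsDedekindDomain.HeightOneSpectrum (NumberField.RingOfIntegers K') in cofinite, ρ'.IsUnramifiedAt v) ∧ ∀ (v : IsDedekindDomain.HeightOneSpectrum (NumberField.RingOfIntegers K')) (hv : ((ℓ' : ℕ) : NumberField.RingOfIntegers K') ∈ v.asIdeal), (Literature.NumberTheory.PAdicHodge.fontainePstAdicCompletion v ℓ' hv).IsDeRhamFramed (ρ'.toLocal v)) → (∀ w : IsDedekindDomain.HeightOneSpectrum (NumberField.RingOfIntegers K'), ((ℓ' : ℕ) : NumberField.RingOfIntegers K') ∉ w.asIdeal → ρ'.IsUnramifiedAt w) → ∃ π : Literature.NumberTheory.Automorphic.CuspidalAutomorphicRepData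 n' K' hcpt', π.1.IsLAlgebraic ∧ ∀ᶠ v : IsDedekindDomain.HeightOneSpectrum (NumberField.RingOfIntegers K') in cofinite, ρ'.IsUnramifiedAt v ∧ (∃ α : Multiset ℂ, π.1.HasSatakeParamAt v α) ∧ ∀ α : Multiset ℂ, π.1.HasSatakeParamAt v α → ∃ P Q : Polynomial (Valued.v : Valuation (PadicAlgCl ℓ') NNReal).valuationSubring, ρ'.HasFrobCharpolyAt v (P.map (Valued.v : Valuation (PadicAlgCl ℓ') NNReal).valuationSubring.subtype) ∧ Literature.NumberTheory.Automorphic.arithFrobPolyOfSatake ι' v.residueCard 1 α = Q.map (Valued.v : Valuation (PadicAlgCl ℓ') NNReal).valuationSubring.subtype ∧ P.map (IsLocalRing.residue (Valued.v : Valuation (PadicAlgCl ℓ') NNReal).valuationSubring) = Q.map (IsLocalRing.residue (Valued.v : Valuation (PadicAlgCl ℓ') NNReal).valuationSubring)) → ∀ (K : Type) [Field K] [NumberField K] (n : ℕ) (hcpt : Literature.NumberTheory.Automorphic.isCompact_glFiniteIntegralLevel n K), 0 < n → ∀ (ι : PadicAlgCl ℓ ≃+* ℂ) (ρ : Literature.NumberTheory.GaloisRepresentations.FramedGaloisRep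 K (PadicAlgCl ℓ) n), ρ.toGaloisRep.IsIrreducible → ((∀ᶠ v : IsDedekindDomain.HeightOneSpectrum (NumberField.RingOfIntegers K) in cofinite, ρ.IsUnramifiedAt v) ∧ ∀ (v : IsDedekindDomain.HeightOneSpectrum (NumberField.RingOfIntegers K)) (hv : ((ℓ : ℕ) : NumberField.RingOfIntegers K) ∈ v.asIdeal), (Literature.NumberTheory.PAdicHodge.fontainePstAdicCompletion v ℓ hv).IsDeRhamFramed (ρ.toLocal v)) → (∀ (v : IsDedekindDomain.HeightOneSpectrum (NumberField.RingOfIntegers K)) (hv : ((ℓ : ℕ) : NumberField.RingOfIntegers K) ∈ v.asIdeal), (Literature.NumberTheory.PAdicHodge.fontainePstAdicCompletion v ℓ hv).IsCrystallineFramed (ρ.toLocal v)) → (∀ w : IsDedekindDomain.HeightOneSpectrum (NumberField.RingOfIntegers K), ((ℓ : ℕ) : NumberField.RingOfIntegers K) ∉ w.asIdeal → ρ.IsUnramifiedAt w) → ∃ π : Literature.NumberTheory.Automorphic.CuspidalAutomorphicRepData n K hcpt, π.1.IsLAlgebraic ∧ ∀ᶠ v : IsDedekindDomain.HeightOneSpectrum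 (NumberField.RingOfIntegers K) in cofinite, ρ.IsUnramifiedAt v ∧ (∃ α : Multiset ℂ, π.1.HasSatakeParamAt v α) ∧ ∀ α : Multiset ℂ, π.1.HasSatakeParamAt v α → ∃ P Q : Polynomial (Valued.v : Valuation (PadicAlgCl ℓ) NNReal).valuationSubring, ρ.HasFrobCharpolyAt v (P.map (Valued.v : Valuation (PadicAlgCl ℓ) NNReal).valuationSubring.subtype) ∧ Literature.NumberTheory.Automorphic.arithFrobPolyOfSatake ι v.residueCard 1 α = Q.map (Valued.v : Valuation (PadicAlgCl ℓ) NNReal).valuationSubring.subtype ∧ P.map (IsLocalRing.residue (Valued.v : Valuation (PadicAlgCl ℓ) NNReal).valuationSubring) = Q.map (IsLocalRing.residue (Valued.v : Valuation (PadicAlgCl ℓ) NNReal).valuationSubring)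

/-- (record) lens-4 g5's F — FINITE-INERTIA DESCENT, byte-identical (cleared STATUS L272, unfiled): M's ρ with a KILLABLE place. -/
def FiniteInertiaDescent : Prop :=
  (∀ (K : Type) [Field K] [NumberField K] (n : ℕ) (hcpt : Literature.NumberTheory.Automorphic.isCompact_glFiniteIntegralLevel n K), 0 < n → ∀ (π : Literature.NumberTheory.Automorphic.CuspidalAutomorphicRepData n K hcpt), π.1.IsLAlgebraic → ∀ (ℓ : ℕ) [Fact ℓ.Prime] (ι : PadicAlgCl ℓ ≃+* ℂ), ∃ ρ : Literature.NumberTheory.GaloisRepresentations.FramedGaloisRep K (PadicAlgCl ℓ) n, ρ.toGaloisRep.IsIrreducible ∧ ∀ᶠ v : IsDedekindDomain.HeightOneSpectrum (NumberField.RingOfIntegers K) in cofinite, SatakeFrobCompatibleAt ι π.1 ρ v) → (∀ (K : Type) [Field K] [NumberField K] (n : ℕ) (hcpt : Literature.NumberTheory.Automorphic.isCompact_glFiniteIntegralLevel n K), 0 < n → ∀ (ℓ : ℕ) [Fact ℓ.Prime] (ι : PadicAlgCl ℓ ≃+* ℂ) (ρ : Literature.NumberTheory.GaloisRepresentations.FramedGaloisRep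 K (PadicAlgCl ℓ) n), ρ.toGaloisRep.IsIrreducible → ((∀ᶠ v : IsDedekindDomain.HeightOneSpectrum (NumberField.RingOfIntegers K) in cofinite, ρ.IsUnramifiedAt v) ∧ ∀ (v : IsDedekindDomain.HeightOneSpectrum (NumberField.RingOfIntegers K)) (hv : ((ℓ : ℕ) : NumberField.RingOfIntegers K) ∈ v.asIdeal), (Literature.NumberTheory.PAdicHodge.fontainePstAdicCompletion v ℓ hv).IsDeRhamFramed (ρ.toLocal v)) → (∃ (π : Literature.NumberTheory.Automorphic.CuspidalAutomorphicRepData n K hcpt) (ρ' : Literature.NumberTheory.GaloisRepresentations.FramedGaloisRep K (PadicAlgCl ℓ) n), π.1.IsLAlgebraic ∧ ρ'.toGaloisRep.IsIrreducible ∧ (∀ᶠ v : IsDedekindDomain.HeightOneSpectrum (NumberField.RingOfIntegers K) in cofinite, SatakeFrobCompatibleAt ι π.1 ρ' v) ∧ ∀ᶠ v : IsDedekindDomain.HeightOneSpectrum (NumberField.RingOfIntegers K) in cofinite, ∃ P P' : Polynomial (Valued.v : Valuation (PadicAlgCl ℓ) NNReal).valuationSubring, ρ.HasFrobCharpolyAt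 v (P.map (Valued.v : Valuation (PadicAlgCl ℓ) NNReal).valuationSubring.subtype) ∧ ρ'.HasFrobCharpolyAt v (P'.map (Valued.v : Valuation (PadicAlgCl ℓ) NNReal).valuationSubring.subtype) ∧ P.map (IsLocalRing.residue (Valued.v : Valuation (PadicAlgCl ℓ) NNReal).valuationSubring) = P'.map (IsLocalRing.residue (Valued.v : Valuation (PadicAlgCl ℓ) NNReal).valuationSubring)) → ∃ π : Literature.NumberTheory.Automorphic.CuspidalAutomorphicRepData n K hcpt, π.1.IsLAlgebraic ∧ ∀ᶠ v : IsDedekindDomain.HeightOneSpectrum (NumberField.RingOfIntegers K) in cofinite, SatakeFrobCompatibleAt ι π.1 ρ v) → ∀ (k ℓ : ℕ) [Fact ℓ.Prime], ¬ (k = 0 ∧ ℓ = 2) → (∀ (k' ℓ' : ℕ) [Fact ℓ'.Prime], (k' < k ∨ (k' = k ∧ ℓ' < ℓ)) → ∀ (K' : Type) [Field K'] [NumberField K'] (n' : ℕ) (hcpt' : Literature.NumberTheory.Automorphic.isCompact_glFiniteIntegralLevel n' K'), 0 < n' → ∀ (ι' : PadicAlgCl ℓ' ≃+* ℂ) (ρ'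 : Literature.NumberTheory.GaloisRepresentations.FramedGaloisRep K' (PadicAlgCl ℓ') n'), ρ'.toGaloisRep.IsIrreducible → ((∀ᶠ v : IsDedekindDomain.HeightOneSpectrum (NumberField.RingOfIntegers K') in cofinite, ρ'.IsUnramifiedAt v) ∧ ∀ (v : IsDedekindDomain.HeightOneSpectrum (NumberField.RingOfIntegers K')) (hv : ((ℓ' : ℕ) : NumberField.RingOfIntegers K') ∈ v.asIdeal), (Literature.NumberTheory.PAdicHodge.fontainePstAdicCompletion v ℓ' hv).IsDeRhamFramed (ρ'.toLocal v)) → (∃ S : Finset (IsDedekindDomain.HeightOneSpectrum (NumberField.RingOfIntegers K')), S.card ≤ k' ∧ ∀ v ∉ S, ((ℓ' : ℕ) : NumberField.RingOfIntegers K') ∉ v.asIdeal → ρ'.IsUnramifiedAt v) → ∃ π : Literature.NumberTheory.Automorphic.CuspidalAutomorphicRepData n' K' hcpt', π.1.IsLAlgebraic ∧ ∀ᶠ v : IsDedekindDomain.HeightOneSpectrum (NumberField.RingOfIntegers K') in cofinite, ρ'.IsUnramifiedAt v ∧ (∃ α : Multiset ℂ, π.1.HasSatakeParamAt v α) ∧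 ∀ α : Multiset ℂ, π.1.HasSatakeParamAt v α → ∃ P Q : Polynomial (Valued.v : Valuation (PadicAlgCl ℓ') NNReal).valuationSubring, ρ'.HasFrobCharpolyAt v (P.map (Valued.v : Valuation (PadicAlgCl ℓ') NNReal).valuationSubring.subtype) ∧ Literature.NumberTheory.Automorphic.arithFrobPolyOfSatake ι' v.residueCard 1 α = Q.map (Valued.v : Valuation (PadicAlgCl ℓ') NNReal).valuationSubring.subtype ∧ P.map (IsLocalRing.residue (Valued.v : Valuation (PadicAlgCl ℓ') NNReal).valuationSubring) = Q.map (IsLocalRing.residue (Valued.v : Valuation (PadicAlgCl ℓ') NNReal).valuationSubring)) → ∀ (K : Type) [Field K] [NumberField K] (n : ℕ) (hcpt : Literature.NumberTheory.Automorphic.isCompact_glFiniteIntegralLevel n K), 0 < n → ∀ (ι : PadicAlgCl ℓ ≃+* ℂ) (ρ : Literature.NumberTheory.GaloisRepresentations.FramedGaloisRep K (PadicAlgCl ℓ) n), ρ.toGaloisRep.IsIrreducible → ((∀ᶠ v : IsDedekindDomain.HeightOneSpectrum (NumberField.RingOfIntegers K) in cofinite, ρ.IsUnramifiedAt v) ∧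 ∀ (v : IsDedekindDomain.HeightOneSpectrum (NumberField.RingOfIntegers K)) (hv : ((ℓ : ℕ) : NumberField.RingOfIntegers K) ∈ v.asIdeal), (Literature.NumberTheory.PAdicHodge.fontainePstAdicCompletion v ℓ hv).IsDeRhamFramed (ρ.toLocal v)) → (∀ (v : IsDedekindDomain.HeightOneSpectrum (NumberField.RingOfIntegers K)) (hv : ((ℓ : ℕ) : NumberField.RingOfIntegers K) ∈ v.asIdeal), (Literature.NumberTheory.PAdicHodge.fontainePstAdicCompletion v ℓ hv).IsCrystallineFramed (ρ.toLocal v)) → (∃ S : Finset (IsDedekindDomain.HeightOneSpectrum (NumberField.RingOfIntegers K)), S.card ≤ k ∧ ∀ v ∉ S, ((ℓ : ℕ) : NumberField.RingOfIntegers K) ∉ v.asIdeal → ρ.IsUnramifiedAt v) → (∀ w : IsDedekindDomain.HeightOneSpectrum (NumberField.RingOfIntegers K), ((ℓ : ℕ) : NumberField.RingOfIntegers K) ∉ w.asIdeal → ¬ ρ.IsUnramifiedAt w → ∀ τ : Field.absoluteGaloisGroup K →* Matrix.GeneralLinearGroup (Fin n) (Literature.NumberTheory.GaloisRepresentations.padicAlgClResidueField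 ℓ), ρ.IsResidualRepOf (RingHom.id (Literature.NumberTheory.GaloisRepresentations.padicAlgClResidueField ℓ)) τ → ¬ (∀ 𝔓 ∈ w.primesAbove, ∀ σ ∈ 𝔓.inertia (Field.absoluteGaloisGroup K), τ σ = 1)) → (∃ w : IsDedekindDomain.HeightOneSpectrum (NumberField.RingOfIntegers K), ((ℓ : ℕ) : NumberField.RingOfIntegers K) ∉ w.asIdeal ∧ ¬ ρ.IsUnramifiedAt w ∧ ∀ 𝔓 ∈ w.primesAbove, (ρ '' (𝔓.inertia (Field.absoluteGaloisGroup K) : Set (Field.absoluteGaloisGroup K))).Finite) → ∃ π : Literature.NumberTheory.Automorphic.CuspidalAutomorphicRepData n K hcpt, π.1.IsLAlgebraic ∧ ∀ᶠ v : IsDedekindDomain.HeightOneSpectrum (NumberField.RingOfIntegers K) in cofinite, ρ.IsUnramifiedAt v ∧ (∃ α : Multiset ℂ, π.1.HasSatakeParamAt v α) ∧ ∀ α : Multiset ℂ, π.1.HasSatakeParamAt v α → ∃ P Q : Polynomial (Valued.v : Valuation (PadicAlgCl ℓ) NNReal).valuationSubring, ρ.HasFrobCharpolyAt v (P.map (Valued.v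 : Valuation (PadicAlgCl ℓ) NNReal).valuationSubring.subtype) ∧ Literature.NumberTheory.Automorphic.arithFrobPolyOfSatake ι v.residueCard 1 α = Q.map (Valued.v : Valuation (PadicAlgCl ℓ) NNReal).valuationSubring.subtype ∧ P.map (IsLocalRing.residue (Valued.v : Valuation (PadicAlgCl ℓ) NNReal).valuationSubring) = Q.map (IsLocalRing.residue (Valued.v : Valuation (PadicAlgCl ℓ) NNReal).valuationSubring)

/-- (record) lens-4 g5's U — MONODROMIC DESCENT, byte-identical (cleared STATUS L272 as the lineage's DECLARED RESIDUAL,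
IDEA-NEEDED): M's MONODROMIC ρ.  DISSOLVED by this node: U ⟸ K ∧ L (`monodromicDescent_of_K_L`), K attackable now. -/
def MonodromicDescent : Prop :=
  (∀ (K : Type) [Field K] [NumberField K] (n : ℕ) (hcpt : Literature.NumberTheory.Automorphic.isCompact_glFiniteIntegralLevel n K), 0 < n → ∀ (π : Literature.NumberTheory.Automorphic.CuspidalAutomorphicRepData n K hcpt), π.1.IsLAlgebraic → ∀ (ℓ : ℕ) [Fact ℓ.Prime] (ι : PadicAlgCl ℓ ≃+* ℂ), ∃ ρ : Literature.NumberTheory.GaloisRepresentations.FramedGaloisRep K (PadicAlgCl ℓ) n, ρ.toGaloisRep.IsIrreducible ∧ ∀ᶠ v : IsDedekindDomain.HeightOneSpectrum (NumberField.RingOfIntegers K) in cofinite, SatakeFrobCompatibleAt ι π.1 ρ v) → (∀ (K : Type) [Field K] [NumberField K] (n : ℕ) (hcpt : Literature.NumberTheory.Automorphic.isCompact_glFiniteIntegralLevel n K), 0 < n → ∀ (ℓ : ℕ) [Fact ℓ.Prime] (ι : PadicAlgCl ℓ ≃+* ℂ) (ρ : Literature.NumberTheory.GaloisRepresentations.FramedGaloisRep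 K (PadicAlgCl ℓ) n), ρ.toGaloisRep.IsIrreducible → ((∀ᶠ v : IsDedekindDomain.HeightOneSpectrum (NumberField.RingOfIntegers K) in cofinite, ρ.IsUnramifiedAt v) ∧ ∀ (v : IsDedekindDomain.HeightOneSpectrum (NumberField.RingOfIntegers K)) (hv : ((ℓ : ℕ) : NumberField.RingOfIntegers K) ∈ v.asIdeal), (Literature.NumberTheory.PAdicHodge.fontainePstAdicCompletion v ℓ hv).IsDeRhamFramed (ρ.toLocal v)) → (∃ (π : Literature.NumberTheory.Automorphic.CuspidalAutomorphicRepData n K hcpt) (ρ' : Literature.NumberTheory.GaloisRepresentations.FramedGaloisRep K (PadicAlgCl ℓ) n), π.1.IsLAlgebraic ∧ ρ'.toGaloisRep.IsIrreducible ∧ (∀ᶠ v : IsDedekindDomain.HeightOneSpectrum (NumberField.RingOfIntegers K) in cofinite, SatakeFrobCompatibleAt ι π.1 ρ' v) ∧ ∀ᶠ v : IsDedekindDomain.HeightOneSpectrum (NumberField.RingOfIntegers K) in cofinite, ∃ P P' : Polynomial (Valued.v : Valuation (PadicAlgCl ℓ) NNReal).valuationSubring, ρ.HasFrobCharpolyAt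 v (P.map (Valued.v : Valuation (PadicAlgCl ℓ) NNReal).valuationSubring.subtype) ∧ ρ'.HasFrobCharpolyAt v (P'.map (Valued.v : Valuation (PadicAlgCl ℓ) NNReal).valuationSubring.subtype) ∧ P.map (IsLocalRing.residue (Valued.v : Valuation (PadicAlgCl ℓ) NNReal).valuationSubring) = P'.map (IsLocalRing.residue (Valued.v : Valuation (PadicAlgCl ℓ) NNReal).valuationSubring)) → ∃ π : Literature.NumberTheory.Automorphic.CuspidalAutomorphicRepData n K hcpt, π.1.IsLAlgebraic ∧ ∀ᶠ v : IsDedekindDomain.HeightOneSpectrum (NumberField.RingOfIntegers K) in cofinite, SatakeFrobCompatibleAt ι π.1 ρ v) → ∀ (k ℓ : ℕ) [Fact ℓ.Prime], ¬ (k = 0 ∧ ℓ = 2) → (∀ (k' ℓ' : ℕ) [Fact ℓ'.Prime], (k' < k ∨ (k' = k ∧ ℓ' < ℓ)) → ∀ (K' : Type) [Field K'] [NumberField K'] (n' : ℕ) (hcpt' : Literature.NumberTheory.Automorphic.isCompact_glFiniteIntegralLevel n' K'), 0 < n' → ∀ (ι' : PadicAlgCl ℓ' ≃+* ℂ) (ρ'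 : Literature.NumberTheory.GaloisRepresentations.FramedGaloisRep K' (PadicAlgCl ℓ') n'), ρ'.toGaloisRep.IsIrreducible → ((∀ᶠ v : IsDedekindDomain.HeightOneSpectrum (NumberField.RingOfIntegers K') in cofinite, ρ'.IsUnramifiedAt v) ∧ ∀ (v : IsDedekindDomain.HeightOneSpectrum (NumberField.RingOfIntegers K')) (hv : ((ℓ' : ℕ) : NumberField.RingOfIntegers K') ∈ v.asIdeal), (Literature.NumberTheory.PAdicHodge.fontainePstAdicCompletion v ℓ' hv).IsDeRhamFramed (ρ'.toLocal v)) → (∃ S : Finset (IsDedekindDomain.HeightOneSpectrum (NumberField.RingOfIntegers K')), S.card ≤ k' ∧ ∀ v ∉ S, ((ℓ' : ℕ) : NumberField.RingOfIntegers K') ∉ v.asIdeal → ρ'.IsUnramifiedAt v) → ∃ π : Literature.NumberTheory.Automorphic.CuspidalAutomorphicRepData n' K' hcpt', π.1.IsLAlgebraic ∧ ∀ᶠ v : IsDedekindDomain.HeightOneSpectrum (NumberField.RingOfIntegers K') in cofinite, ρ'.IsUnramifiedAt v ∧ (∃ α : Multiset ℂ, π.1.HasSatakeParamAt v α) ∧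 ∀ α : Multiset ℂ, π.1.HasSatakeParamAt v α → ∃ P Q : Polynomial (Valued.v : Valuation (PadicAlgCl ℓ') NNReal).valuationSubring, ρ'.HasFrobCharpolyAt v (P.map (Valued.v : Valuation (PadicAlgCl ℓ') NNReal).valuationSubring.subtype) ∧ Literature.NumberTheory.Automorphic.arithFrobPolyOfSatake ι' v.residueCard 1 α = Q.map (Valued.v : Valuation (PadicAlgCl ℓ') NNReal).valuationSubring.subtype ∧ P.map (IsLocalRing.residue (Valued.v : Valuation (PadicAlgCl ℓ') NNReal).valuationSubring) = Q.map (IsLocalRing.residue (Valued.v : Valuation (PadicAlgCl ℓ') NNReal).valuationSubring)) → ∀ (K : Type) [Field K] [NumberField K] (n : ℕ) (hcpt : Literature.NumberTheory.Automorphic.isCompact_glFiniteIntegralLevel n K), 0 < n → ∀ (ι : PadicAlgCl ℓ ≃+* ℂ) (ρ : Literature.NumberTheory.GaloisRepresentations.FramedGaloisRep K (PadicAlgCl ℓ) n), ρ.toGaloisRep.IsIrreducible → ((∀ᶠ v : IsDedekindDomain.HeightOneSpectrum (NumberField.RingOfIntegers K) in cofinite, ρ.IsUnramifiedAt v) ∧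 ∀ (v : IsDedekindDomain.HeightOneSpectrum (NumberField.RingOfIntegers K)) (hv : ((ℓ : ℕ) : NumberField.RingOfIntegers K) ∈ v.asIdeal), (Literature.NumberTheory.PAdicHodge.fontainePstAdicCompletion v ℓ hv).IsDeRhamFramed (ρ.toLocal v)) → (∀ (v : IsDedekindDomain.HeightOneSpectrum (NumberField.RingOfIntegers K)) (hv : ((ℓ : ℕ) : NumberField.RingOfIntegers K) ∈ v.asIdeal), (Literature.NumberTheory.PAdicHodge.fontainePstAdicCompletion v ℓ hv).IsCrystallineFramed (ρ.toLocal v)) → (∃ S : Finset (IsDedekindDomain.HeightOneSpectrum (NumberField.RingOfIntegers K)), S.card ≤ k ∧ ∀ v ∉ S, ((ℓ : ℕ) : NumberField.RingOfIntegers K) ∉ v.asIdeal → ρ.IsUnramifiedAt v) → (∀ w : IsDedekindDomain.HeightOneSpectrum (NumberField.RingOfIntegers K), ((ℓ : ℕ) : NumberField.RingOfIntegers K) ∉ w.asIdeal → ¬ ρ.IsUnramifiedAt w → ∀ τ : Field.absoluteGaloisGroup K →* Matrix.GeneralLinearGroup (Fin n) (Literature.NumberTheory.GaloisRepresentations.padicAlgClResidueField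 ℓ), ρ.IsResidualRepOf (RingHom.id (Literature.NumberTheory.GaloisRepresentations.padicAlgClResidueField ℓ)) τ → ¬ (∀ 𝔓 ∈ w.primesAbove, ∀ σ ∈ 𝔓.inertia (Field.absoluteGaloisGroup K), τ σ = 1)) → ((∃ w : IsDedekindDomain.HeightOneSpectrum (NumberField.RingOfIntegers K), ((ℓ : ℕ) : NumberField.RingOfIntegers K) ∉ w.asIdeal ∧ ¬ ρ.IsUnramifiedAt w) ∧ ∀ w : IsDedekindDomain.HeightOneSpectrum (NumberField.RingOfIntegers K), ((ℓ : ℕ) : NumberField.RingOfIntegers K) ∉ w.asIdeal → ¬ ρ.IsUnramifiedAt w → ¬ (∀ 𝔓 ∈ w.primesAbove, (ρ '' (𝔓.inertia (Field.absoluteGaloisGroup K) : Set (Field.absoluteGaloisGroup K))).Finite)) → ∃ π : Literature.NumberTheory.Automorphic.CuspidalAutomorphicRepData n K hcpt, π.1.IsLAlgebraic ∧ ∀ᶠ v : IsDedekindDomain.HeightOneSpectrum (NumberField.RingOfIntegers K) in cofinite, ρ.IsUnramifiedAt v ∧ (∃ α : Multiset ℂ, π.1.HasSatakeParamAt v α)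 ∧ ∀ α : Multiset ℂ, π.1.HasSatakeParamAt v α → ∃ P Q : Polynomial (Valued.v : Valuation (PadicAlgCl ℓ) NNReal).valuationSubring, ρ.HasFrobCharpolyAt v (P.map (Valued.v : Valuation (PadicAlgCl ℓ) NNReal).valuationSubring.subtype) ∧ Literature.NumberTheory.Automorphic.arithFrobPolyOfSatake ι v.residueCard 1 α = Q.map (Valued.v : Valuation (PadicAlgCl ℓ) NNReal).valuationSubring.subtype ∧ P.map (IsLocalRing.residue (Valued.v : Valuation (PadicAlgCl ℓ) NNReal).valuationSubring) = Q.map (IsLocalRing.residue (Valued.v : Valuation (PadicAlgCl ℓ) NNReal).valuationSubring)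

/-- [glue · pure logic · PROVED below (`levelPrimeDescent_of_four`)] W → L → K → Z → D (the resplit glue, k = 4). -/
def FourGlue : Prop :=
  MinimalLevelDescent.WeightMove → MinimalLevelDescent.LevelMove → ResidualInertiaDescent → LevelOneCrystallineDescent →
    MinimalLevelDescent.LevelPrimeDescent

/-! ## Bridges between the inlined texts and the vocabulary (all `Iff.rfl`) -/

/-- M₀ — the RETIRED item stmt-Langlands-28625 (decl `MinimalCrystallineDescent` of the route MinimalLevelDescent), TEXT OF RECORD (g4; retired by the rev-3
resplit of 2026-08-30T08:44:51Z, replaced EXACTLY mod L by K ∧ Z — `minimalCrystallineDescent_iff_pieces` below is that certificate, kept as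
checkable history over this local copy; nothing load-bearing goes through M₀ any more). -/
def MinimalCrystallineDescent₀ : Prop :=
  (∀ (K : Type) [Field K] [NumberField K] (n : ℕ) (hcpt : Literature.NumberTheory.Automorphic.isCompact_glFiniteIntegralLevel n K), 0 < n → ∀ (π : Literature.NumberTheory.Automorphic.CuspidalAutomorphicRepData n K hcpt), π.1.IsLAlgebraic → ∀ (ℓ : ℕ) [Fact ℓ.Prime] (ι : PadicAlgCl ℓ ≃+* ℂ), ∃ ρ : Literature.NumberTheory.GaloisRepresentations.FramedGaloisRep K (PadicAlgCl ℓ) n, ρ.toGaloisRep.IsIrreducible ∧ ∀ᶠ v : IsDedekindDomain.HeightOneSpectrum (NumberField.RingOfIntegers K) in cofinite, SatakeFrobCompatibleAt ι π.1 ρ v) → (∀ (K : Type) [Field K] [NumberField K] (n : ℕ) (hcpt : Literature.NumberTheory.Automorphic.isCompact_glFiniteIntegralLevel n K), 0 < n → ∀ (ℓ : ℕ) [Fact ℓ.Prime] (ι : PadicAlgCl ℓ ≃+* ℂ) (ρ : Literature.NumberTheory.GaloisRepresentations.FramedGaloisRep K (PadicAlgCl ℓ) n), ρ.toGaloisRep.IsIrreducible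 → ((∀ᶠ v : IsDedekindDomain.HeightOneSpectrum (NumberField.RingOfIntegers K) in cofinite, ρ.IsUnramifiedAt v) ∧ ∀ (v : IsDedekindDomain.HeightOneSpectrum (NumberField.RingOfIntegers K)) (hv : ((ℓ : ℕ) : NumberField.RingOfIntegers K) ∈ v.asIdeal), (Literature.NumberTheory.PAdicHodge.fontainePstAdicCompletion v ℓ hv).IsDeRhamFramed (ρ.toLocal v)) → (∃ (π : Literature.NumberTheory.Automorphic.CuspidalAutomorphicRepData n K hcpt) (ρ' : Literature.NumberTheory.GaloisRepresentations.FramedGaloisRep K (PadicAlgCl ℓ) n), π.1.IsLAlgebraic ∧ ρ'.toGaloisRep.IsIrreducible ∧ (∀ᶠ v : IsDedekindDomain.HeightOneSpectrum (NumberField.RingOfIntegers K) in cofinite, SatakeFrobCompatibleAt ι π.1 ρ' v) ∧ ∀ᶠ v : IsDedekindDomain.HeightOneSpectrum (NumberField.RingOfIntegers K) in cofinite, ∃ P P' : Polynomial (Valued.v : Valuation (PadicAlgCl ℓ) NNReal).valuationSubring, ρ.HasFrobCharpolyAt v (P.map (Valued.v : Valuation (PadicAlgCl ℓ) NNReal).valuationSubring.subtype)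 ∧ ρ'.HasFrobCharpolyAt v (P'.map (Valued.v : Valuation (PadicAlgCl ℓ) NNReal).valuationSubring.subtype) ∧ P.map (IsLocalRing.residue (Valued.v : Valuation (PadicAlgCl ℓ) NNReal).valuationSubring) = P'.map (IsLocalRing.residue (Valued.v : Valuation (PadicAlgCl ℓ) NNReal).valuationSubring)) → ∃ π : Literature.NumberTheory.Automorphic.CuspidalAutomorphicRepData n K hcpt, π.1.IsLAlgebraic ∧ ∀ᶠ v : IsDedekindDomain.HeightOneSpectrum (NumberField.RingOfIntegers K) in cofinite, SatakeFrobCompatibleAt ι π.1 ρ v) → ∀ (k ℓ : ℕ) [Fact ℓ.Prime], ¬ (k = 0 ∧ ℓ = 2) → (∀ (k' ℓ' : ℕ) [Fact ℓ'.Prime], (k' < k ∨ (k' = k ∧ ℓ' < ℓ)) → ∀ (K' : Type) [Field K'] [NumberField K'] (n' : ℕ) (hcpt' : Literature.NumberTheory.Automorphic.isCompact_glFiniteIntegralLevel n' K'), 0 < n' → ∀ (ι' : PadicAlgCl ℓ' ≃+* ℂ) (ρ' : Literature.NumberTheory.GaloisRepresentations.FramedGaloisRep K' (PadicAlgCl ℓ')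 n'), ρ'.toGaloisRep.IsIrreducible → ((∀ᶠ v : IsDedekindDomain.HeightOneSpectrum (NumberField.RingOfIntegers K') in cofinite, ρ'.IsUnramifiedAt v) ∧ ∀ (v : IsDedekindDomain.HeightOneSpectrum (NumberField.RingOfIntegers K')) (hv : ((ℓ' : ℕ) : NumberField.RingOfIntegers K') ∈ v.asIdeal), (Literature.NumberTheory.PAdicHodge.fontainePstAdicCompletion v ℓ' hv).IsDeRhamFramed (ρ'.toLocal v)) → (∃ S : Finset (IsDedekindDomain.HeightOneSpectrum (NumberField.RingOfIntegers K')), S.card ≤ k' ∧ ∀ v ∉ S, ((ℓ' : ℕ) : NumberField.RingOfIntegers K') ∉ v.asIdeal → ρ'.IsUnramifiedAt v) → ∃ π : Literature.NumberTheory.Automorphic.CuspidalAutomorphicRepData n' K' hcpt', π.1.IsLAlgebraic ∧ ∀ᶠ v : IsDedekindDomain.HeightOneSpectrum (NumberField.RingOfIntegers K') in cofinite, ρ'.IsUnramifiedAt v ∧ (∃ α : Multiset ℂ, π.1.HasSatakeParamAt v α) ∧ ∀ α : Multiset ℂ, π.1.HasSatakeParamAt v α → ∃ P Q : Polynomial (Valued.v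 : Valuation (PadicAlgCl ℓ') NNReal).valuationSubring, ρ'.HasFrobCharpolyAt v (P.map (Valued.v : Valuation (PadicAlgCl ℓ') NNReal).valuationSubring.subtype) ∧ Literature.NumberTheory.Automorphic.arithFrobPolyOfSatake ι' v.residueCard 1 α = Q.map (Valued.v : Valuation (PadicAlgCl ℓ') NNReal).valuationSubring.subtype ∧ P.map (IsLocalRing.residue (Valued.v : Valuation (PadicAlgCl ℓ') NNReal).valuationSubring) = Q.map (IsLocalRing.residue (Valued.v : Valuation (PadicAlgCl ℓ') NNReal).valuationSubring)) → ∀ (K : Type) [Field K] [NumberField K] (n : ℕ) (hcpt : Literature.NumberTheory.Automorphic.isCompact_glFiniteIntegralLevel n K), 0 < n → ∀ (ι : PadicAlgCl ℓ ≃+* ℂ) (ρ : Literature.NumberTheory.GaloisRepresentations.FramedGaloisRep K (PadicAlgCl ℓ) n), ρ.toGaloisRep.IsIrreducible → ((∀ᶠ v : IsDedekindDomain.HeightOneSpectrum (NumberField.RingOfIntegers K) in cofinite, ρ.IsUnramifiedAt v) ∧ ∀ (v : IsDedekindDomain.HeightOneSpectrum (NumberField.RingOfIntegers K)) (hv : ((ℓ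 : ℕ) : NumberField.RingOfIntegers K) ∈ v.asIdeal), (Literature.NumberTheory.PAdicHodge.fontainePstAdicCompletion v ℓ hv).IsDeRhamFramed (ρ.toLocal v)) → (∀ (v : IsDedekindDomain.HeightOneSpectrum (NumberField.RingOfIntegers K)) (hv : ((ℓ : ℕ) : NumberField.RingOfIntegers K) ∈ v.asIdeal), (Literature.NumberTheory.PAdicHodge.fontainePstAdicCompletion v ℓ hv).IsCrystallineFramed (ρ.toLocal v)) → (∃ S : Finset (IsDedekindDomain.HeightOneSpectrum (NumberField.RingOfIntegers K)), S.card ≤ k ∧ ∀ v ∉ S, ((ℓ : ℕ) : NumberField.RingOfIntegers K) ∉ v.asIdeal → ρ.IsUnramifiedAt v) → (∀ w : IsDedekindDomain.HeightOneSpectrum (NumberField.RingOfIntegers K), ((ℓ : ℕ) : NumberField.RingOfIntegers K) ∉ w.asIdeal → ¬ ρ.IsUnramifiedAt w → ∀ τ : Field.absoluteGaloisGroup K →* Matrix.GeneralLinearGroup (Fin n) (Literature.NumberTheory.GaloisRepresentations.padicAlgClResidueField ℓ), ρ.IsResidualRepOf (RingHom.id (Literature.NumberTheory.GaloisRepresentations.padicAlgClResidueField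 ℓ)) τ → ¬ (∀ 𝔓 ∈ w.primesAbove, ∀ σ ∈ 𝔓.inertia (Field.absoluteGaloisGroup K), τ σ = 1)) → ∃ π : Literature.NumberTheory.Automorphic.CuspidalAutomorphicRepData n K hcpt, π.1.IsLAlgebraic ∧ ∀ᶠ v : IsDedekindDomain.HeightOneSpectrum (NumberField.RingOfIntegers K) in cofinite, ρ.IsUnramifiedAt v ∧ (∃ α : Multiset ℂ, π.1.HasSatakeParamAt v α) ∧ ∀ α : Multiset ℂ, π.1.HasSatakeParamAt v α → ∃ P Q : Polynomial (Valued.v : Valuation (PadicAlgCl ℓ) NNReal).valuationSubring, ρ.HasFrobCharpolyAt v (P.map (Valued.v : Valuation (PadicAlgCl ℓ) NNReal).valuationSubring.subtype) ∧ Literature.NumberTheory.Automorphic.arithFrobPolyOfSatake ι v.residueCard 1 α = Q.map (Valued.v : Valuation (PadicAlgCl ℓ) NNReal).valuationSubring.subtype ∧ P.map (IsLocalRing.residue (Valued.v : Valuation (PadicAlgCl ℓ) NNReal).valuationSubring) = Q.map (IsLocalRing.residue (Valued.v : Valuation (PadicAlgCl ℓ) NNReal).valuationSubring)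


/-! ## The level-one piece in M's verbatim height frame (for the record: the frame collapses, pure logic) -/

/-- Z in M's verbatim frame: M restricted to the level-one ρ (all heights (k, ℓ), D's IH, level ≤ k, lift-minimal kept). -/
def LevelOneSliceFrame : Prop :=
  WPlus → LiftW → ∀ (k ℓ : ℕ) [Fact ℓ.Prime], ¬ (k = 0 ∧ ℓ = 2) → IHBelow k ℓ →
    ∀ (K : Type) [Field K] [NumberField K] (n : ℕ) (hcpt : isCompact_glFiniteIntegralLevel n K), 0 < n →
      ∀ (ι : PadicAlgCl ℓ ≃+* ℂ) (ρ : FramedGaloisRep K (PadicAlgCl ℓ) n), ρ.toGaloisRep.IsIrreducible →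
        IsPinnedGeometric ρ → IsCrystallineAbove ρ → HasLevelAtMost ρ k → IsLiftMinimal ρ → IsUnramifiedAwayFrom ρ →
          IsResiduallyAutomorphic hcpt ι ρ


/-- SD — SOLUBLE DESCENT: the ledger item stmt-Langlands-29341 = `SolvableReachSplit.SolvableDescent` (lens-3-g5 support,
route-Langlands-SolvableReachSplit rev 0), inlined byte-identically (`solvableDescent_iff_item` is `Iff.rfl`).  PRINT modulo W⁺:
Arthur–Clozel cyclic prime-degree descent + strong multiplicity one + Clifford (ACC 2023 Prop 6.5.13 (2) with W⁺ for HLTT). -/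
def SolvableDescent : Prop :=
  (∀ (K : Type) [Field K] [NumberField K] (n : ℕ) (hcpt : Literature.NumberTheory.Automorphic.isCompact_glFiniteIntegralLevel n K), 0 < n → ∀ (π : Literature.NumberTheory.Automorphic.CuspidalAutomorphicRepData n K hcpt), π.1.IsLAlgebraic → ∀ (ℓ : ℕ) [Fact ℓ.Prime] (ι : PadicAlgCl ℓ ≃+* ℂ), ∃ ρ : Literature.NumberTheory.GaloisRepresentations.FramedGaloisRep K (PadicAlgCl ℓ) n, ρ.toGaloisRep.IsIrreducible ∧ ∀ᶠ v : IsDedekindDomain.HeightOneSpectrum (NumberField.RingOfIntegers K) in cofinite, SatakeFrobCompatibleAt ι π.1 ρ v) → ∀ (K : Type) [Field K] [NumberField K] (n : ℕ) (hcpt : Literature.NumberTheory.Automorphic.isCompact_glFiniteIntegralLevel n K), 0 < n → ∀ (ℓ : ℕ) [Fact ℓ.Prime] (ι : PadicAlgCl ℓ ≃+* ℂ) (ρ : Literature.NumberTheory.GaloisRepresentations.FramedGaloisRep K (PadicAlgCl ℓ) n), ρ.toGaloisRep.IsIrreducible → ((∀ᶠ v : IsDedekindDomain.HeightOneSpectrum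 (NumberField.RingOfIntegers K) in cofinite, ρ.IsUnramifiedAt v) ∧ ∀ (v : IsDedekindDomain.HeightOneSpectrum (NumberField.RingOfIntegers K)) (hv : ((ℓ : ℕ) : NumberField.RingOfIntegers K) ∈ v.asIdeal), (Literature.NumberTheory.PAdicHodge.fontainePstAdicCompletion v ℓ hv).IsDeRhamFramed (ρ.toLocal v)) → ∀ (L : Type) [Field L] [NumberField L] [Algebra K L], IsGalois K L → IsSolvable (L ≃ₐ[K] L) → ∀ (hcptL : Literature.NumberTheory.Automorphic.isCompact_glFiniteIntegralLevel n L), (ρ.restrictField L).toGaloisRep.IsIrreducible → (∃ πL : Literature.NumberTheory.Automorphic.CuspidalAutomorphicRepData n L hcptL, πL.1.IsLAlgebraic ∧ ∀ᶠ w : IsDedekindDomain.HeightOneSpectrum (NumberField.RingOfIntegers L) in cofinite, SatakeFrobCompatibleAt ι πL.1 (ρ.restrictField L) w) → ∃ π : Literature.NumberTheory.Automorphic.CuspidalAutomorphicRepData n K hcpt, π.1.IsLAlgebraic ∧ ∀ᶠ v : IsDedekindDomain.HeightOneSpectrum (NumberField.RingOfIntegers K) in cofinite, SatakeFrobCompatibleAt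 ι π.1 ρ v


/-- BC — SOLUBLE BASE CHANGE, ascending, in a tower K ⊆ L ⊆ M with M/L Galois solvable and ρ|Γ_M irreducible (lens-4 g5's stub,
byte-identical).  PRINT modulo W⁺: Arthur–Clozel 1989 Thm III.4.2 (tree fact `BaseChangeGLn.exists_baseChange_cyclic`) along a
composition series of Gal(M/L); cuspidality of each step from ρ|Γ_M irreducible via W⁺ + strong multiplicity one. -/
def SolvableBaseChange : Prop :=
  (∀ (K : Type) [Field K] [NumberField K] (n : ℕ) (hcpt : Literature.NumberTheory.Automorphic.isCompact_glFiniteIntegralLevel n K), 0 < n → ∀ (π : Literature.NumberTheory.Automorphic.CuspidalAutomorphicRepData n K hcpt), π.1.IsLAlgebraic → ∀ (ℓ : ℕ) [Fact ℓ.Prime] (ι : PadicAlgCl ℓ ≃+* ℂ), ∃ ρ : Literature.NumberTheory.GaloisRepresentations.FramedGaloisRep K (PadicAlgCl ℓ) n, ρ.toGaloisRep.IsIrreducible ∧ ∀ᶠ v : IsDedekindDomain.HeightOneSpectrum (NumberField.RingOfIntegers K) in cofinite, SatakeFrobCompatibleAt ι π.1 ρ v) → ∀ (K : Type) [Field K]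 [NumberField K] (L : Type) [Field L] [NumberField L] [Algebra K L] (M : Type) [Field M] [NumberField M] [Algebra K M] [Algebra L M] [IsScalarTower K L M] (n : ℕ) (hcptL : Literature.NumberTheory.Automorphic.isCompact_glFiniteIntegralLevel n L) (hcptM : Literature.NumberTheory.Automorphic.isCompact_glFiniteIntegralLevel n M), 0 < n → IsGalois L M → IsSolvable (M ≃ₐ[L] M) → ∀ (ℓ : ℕ) [Fact ℓ.Prime] (ι : PadicAlgCl ℓ ≃+* ℂ) (ρ : Literature.NumberTheory.GaloisRepresentations.FramedGaloisRep K (PadicAlgCl ℓ) n), (ρ.restrictField L).toGaloisRep.IsIrreducible → ((∀ᶠ v : IsDedekindDomain.HeightOneSpectrum (NumberField.RingOfIntegers L) in cofinite, (ρ.restrictField L).IsUnramifiedAt v) ∧ ∀ (v : IsDedekindDomain.HeightOneSpectrum (NumberField.RingOfIntegers L)) (hv : ((ℓ : ℕ) : NumberField.RingOfIntegers L) ∈ v.asIdeal), (Literature.NumberTheory.PAdicHodge.fontainePstAdicCompletion v ℓ hv).IsDeRhamFramed ((ρ.restrictField L).toLocal v)) → (ρ.restrictField M).toGaloisRep.IsIrreducible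 → (∃ πL : Literature.NumberTheory.Automorphic.CuspidalAutomorphicRepData n L hcptL, πL.1.IsLAlgebraic ∧ ∀ᶠ w : IsDedekindDomain.HeightOneSpectrum (NumberField.RingOfIntegers L) in cofinite, SatakeFrobCompatibleAt ι πL.1 (ρ.restrictField L) w) → ∃ πM : Literature.NumberTheory.Automorphic.CuspidalAutomorphicRepData n M hcptM, πM.1.IsLAlgebraic ∧ ∀ᶠ w : IsDedekindDomain.HeightOneSpectrum (NumberField.RingOfIntegers M) in cofinite, SatakeFrobCompatibleAt ι πM.1 (ρ.restrictField M) w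

/-- T⁺ — THE RESIDUAL-KILLING TOWER (NEW, elementary; no automorphy): an irreducible pinned-geometric crystalline ρ of level ≤ k
with a ramified place w ∤ ℓ admits number fields K ⊆ L ⊆ M, M/K finite Galois SOLVABLE, ρ|Γ_M (hence ρ|Γ_L) irreducible, ρ|Γ_L
pinned-geometric and crystalline above ℓ, and EITHER of level ≤ k − 1 (w is dead over L) OR of level ≤ k and NON-MINIMAL at some
w′ (ρ|Γ_L ramifies at w′, a witnessed semisimplified reduction does not).  Construction: τ₀ = a reduction of an integral model of
ρ has finite image (𝔪 is open), E = K^{ker τ₀}; a Grunwald–Wang tower of global cyclic PRIME-degree steps (never GW-special) whose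
completions at the unique place above w climb a composition series of the (solvable!) local extension E_w/K_w — so over L there
is ONE place w′ above w and E L/L is split above w′: τ₀|Γ_L, a reduction of ρ|Γ_L, is unramified at w′ and so is its
semisimplification τ (ker τ₀ ≤ ker τ); each step INERT (one place above) at the other ≤ k − 1 ramified places away from ℓ, and
SPLIT at auxiliary Chebotarev primes v₁ … v_r (one Frobenius in each conjugacy class of Gal(K₁/K), K₁ = K^{ρ⁻¹(G⁰)}, G the Zariski
closure of ρ(Γ_K)): the v_i split completely in the Galois closure M, so Gal(K₁/K₁ ∩ M) is a normal subgroup of Gal(K₁/K) meeting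
every conjugacy class, = the whole group, M ∩ K₁ = K, ρ(Γ_M) is Zariski-dense in G and ρ|Γ_M is irreducible.  No condition above ℓ
(crystalline / de Rham restrict).  If ρ(I_{w′}) dies too the level drops (first disjunct), else ρ|Γ_L is non-minimal at w′. -/
def ResidualKillingTower : Prop :=
  ∀ (K : Type) [Field K] [NumberField K] (n ℓ : ℕ) [Fact ℓ.Prime] (ρ : FramedGaloisRep K (PadicAlgCl ℓ) n) (k : ℕ),
    ρ.toGaloisRep.IsIrreducible → IsPinnedGeometric ρ → IsCrystallineAbove ρ → HasLevelAtMost ρ k → HasRamifiedPlace ρ →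
      ∃ (L : Type) (_ : Field L) (_ : NumberField L) (_ : Algebra K L)
        (M : Type) (_ : Field M) (_ : NumberField M) (_ : Algebra K M) (_ : Algebra L M) (_ : IsScalarTower K L M),
        IsGalois K M ∧ IsSolvable (M ≃ₐ[K] M) ∧
          (ρ.restrictField L).toGaloisRep.IsIrreducible ∧ (ρ.restrictField M).toGaloisRep.IsIrreducible ∧
            IsPinnedGeometric (ρ.restrictField L) ∧ IsCrystallineAbove (ρ.restrictField L) ∧
              (HasLevelAtMost (ρ.restrictField L) (k - 1) ∨
                (HasLevelAtMost (ρ.restrictField L) k ∧ ∃ w', IsNonMinimalAt (ρ.restrictField L) w'))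


/-! # g7 — THE DYADIC COMPANION SPLIT OF THE RESIDUAL Z

Z ⟸ E ∧ I ∧ U through the companion form C₂ (C₂ ⟹ Z; C₂ ⟺ E ∧ I ∧ U), all strictly weaker than the summit (kernel certificates
`*_of_langlands`), none of them an automorphy statement; E ⟸ the open item stmt-Langlands-18969 by name. -/

section Dyadic

variable {p : ℕ} [Fact p.Prime]

/-- Companion matching through (ι, ι₂): at almost every place ONE multiset α ⊂ ℂ (of inverse Satake type) gives the Frobenius
polynomial of ρ through ι and of ρ₂ through ι₂ (`arithFrobPolyOfSatake _ q 1 α = ∏ (X - ι⁻¹(a⁻¹))`): the typed form of "ρ and ρ₂ are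
members of one weakly compatible system", with no coefficient number field. -/
def CompanionMatch (ι : PadicAlgCl ℓ ≃+* ℂ) (ι₂ : PadicAlgCl p ≃+* ℂ) (ρ : FramedGaloisRep K (PadicAlgCl ℓ) n)
    (ρ₂ : FramedGaloisRep K (PadicAlgCl p) n) : Prop :=
  ∀ᶠ v : HeightOneSpectrum (𝓞 K) in cofinite, ∃ α : Multiset ℂ,
    ρ.HasFrobCharpolyAt v (arithFrobPolyOfSatake ι v.residueCard 1 α) ∧
      ρ₂.HasFrobCharpolyAt v (arithFrobPolyOfSatake ι₂ v.residueCard 1 α)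

/-! ## The pieces (one-line self-contained Props over tree declarations = the texts of `texts7.json`) -/

/-- [intermediate node, NOT a piece · WEAKER than the summit (`dyadicLevelOneCompanion_of_langlands`) · implies Z outright
(`levelOneCrystallineDescent_of_companion`) · EXACTLY E ∧ I ∧ U (`dyadicLevelOneCompanion_iff_pieces`)]
C₂ — DYADIC LEVEL-ONE COMPANION.  For every number field K, n ≥ 1, ODD prime ℓ, ι : ℚ̄_ℓ ≅ ℂ, every IRREDUCIBLE pinned-geometric
ℓ-adic ρ : Γ_K → GL_n(ℚ̄_ℓ) CRYSTALLINE above ℓ and UNRAMIFIED away from ℓ (the normal form of the minimal counterexample after g6) and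
every ι₂ : ℚ̄₂ ≅ ℂ, there is an IRREDUCIBLE pinned-geometric 2-adic ρ₂ : Γ_K → GL_n(ℚ̄₂), UNRAMIFIED AWAY FROM 2, whose Frobenius
polynomials match those of ρ through (ι, ι₂) at almost all places.  Pure Galois side: no π, no residual automorphy, no induction. -/
def DyadicLevelOneCompanion : Prop :=
  ∀ (K : Type) [Field K] [NumberField K] (n : ℕ), 0 < n → ∀ (ℓ : ℕ) [Fact ℓ.Prime], ℓ ≠ 2 → ∀ (ι : PadicAlgCl ℓ ≃+* ℂ) (ρ : Literature.NumberTheory.GaloisRepresentations.FramedGaloisRep K (PadicAlgCl ℓ) n), ρ.toGaloisRep.IsIrreducible → ((∀ᶠ v : IsDedekindDomain.HeightOneSpectrum (NumberField.RingOfIntegers K) in cofinite, ρ.IsUnramifiedAt v) ∧ ∀ (v : IsDedekindDomain.HeightOneSpectrum (NumberField.RingOfIntegers K)) (hv : ((ℓ : ℕ) : NumberField.RingOfIntegers K) ∈ v.asIdeal), (Literature.NumberTheory.PAdicHodge.fontainePstAdicCompletion v ℓ hv).IsDeRhamFramed (ρ.toLocal v)) → (∀ (v : IsDedekindDomain.HeightOneSpectrum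 (NumberField.RingOfIntegers K)) (hv : ((ℓ : ℕ) : NumberField.RingOfIntegers K) ∈ v.asIdeal), (Literature.NumberTheory.PAdicHodge.fontainePstAdicCompletion v ℓ hv).IsCrystallineFramed (ρ.toLocal v)) → (∀ w : IsDedekindDomain.HeightOneSpectrum (NumberField.RingOfIntegers K), ((ℓ : ℕ) : NumberField.RingOfIntegers K) ∉ w.asIdeal → ρ.IsUnramifiedAt w) → ∀ (ι₂ : PadicAlgCl 2 ≃+* ℂ), ∃ ρ₂ : Literature.NumberTheory.GaloisRepresentations.FramedGaloisRep K (PadicAlgCl 2) n, ρ₂.toGaloisRep.IsIrreducible ∧ ((∀ᶠ v : IsDedekindDomain.HeightOneSpectrum (NumberField.RingOfIntegers K) in cofinite, ρ₂.IsUnramifiedAt v) ∧ ∀ (v : IsDedekindDomain.HeightOneSpectrum (NumberField.RingOfIntegers K)) (hv : ((2 : ℕ) : NumberField.RingOfIntegers K) ∈ v.asIdeal), (Literature.NumberTheory.PAdicHodge.fontainePstAdicCompletion v 2 hv).IsDeRhamFramed (ρ₂.toLocal v)) ∧ (∀ w : IsDedekindDomain.HeightOneSpectrum (NumberField.RingOfIntegers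 K), ((2 : ℕ) : NumberField.RingOfIntegers K) ∉ w.asIdeal → ρ₂.IsUnramifiedAt w) ∧ (∀ᶠ v : IsDedekindDomain.HeightOneSpectrum (NumberField.RingOfIntegers K) in cofinite, ∃ α : Multiset ℂ, ρ.HasFrobCharpolyAt v (Literature.NumberTheory.Automorphic.arithFrobPolyOfSatake ι v.residueCard 1 α) ∧ ρ₂.HasFrobCharpolyAt v (Literature.NumberTheory.Automorphic.arithFrobPolyOfSatake ι₂ v.residueCard 1 α))

/-- [crux · WEAKER than the summit (`dyadicCompanionExistence_of_langlands`), than C₂, and than the OPEN ITEM stmt-Langlands-18969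
`CompatibleFamilySplit.GeometricCompanions` BY KERNEL IMPLICATION (`dyadicCompanionExistence_of_geometricCompanions`: its slice
ℓ′ = 2 on level-one crystalline ρ, semisimplicity and the uniform-in-ℓ′ Satake function dropped) · LEAF TAGS: ATTACKABLE-IN-PRINT on the
polarizable sector (K CM or totally real; ρ totally odd, essentially (conjugate-)self-dual, Hodge–Tate regular, potentially diagonalizable
above ℓ — e.g. Fontaine–Laffaille —, ℓ ≥ 2(n + 1), ζ_ℓ ∉ K, ρ̄|Γ_{K(ζ_ℓ)} irreducible: Barnet-Lamb–Gee–Geraghty–Taylor, *Potential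
automorphy and change of weight*, Thm 5.5.1 "r is part of a strictly pure compatible system" [corpus: paper:arxiv-1010.2561 p.39–40],
read at λ ∣ 2 through ι₂⁻¹ ∘ ι; n = 1, any K: algebraic Hecke characters — Weil 1956 / Serre 1968 Ch. III) · IDEA-NEEDED off that sector
(even or non-polarizable ρ, irregular weight, general K: no potential automorphy, no motive) · INSTRUMENTABLE (the void theorems make
it vacuous in ranges: Fontaine 1985 / Abrashkin 1989 — no non-zero level-one crystalline ρ over ℚ with Hodge–Tate range < ℓ − 1 of
motivic weight ≤ … ; Calegari's even n = 2 non-existence)]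
E — DYADIC COMPANION EXISTENCE: for ρ as in C₂ and every ι₂ there is a pinned-geometric 2-adic ρ₂ (a.e. unramified, de Rham above 2)
matching ρ through (ι, ι₂).  Why strictly weaker than the summit: a bare existence statement on the Galois side for level-one
crystalline ρ only — no automorphy, no irreducibility, no ramification control; implied by item 18969 and by the summit, and neither
the tree nor print runs it back to either. -/
def DyadicCompanionExistence : Prop :=
  ∀ (K : Type) [Field K] [NumberField K] (n : ℕ), 0 < n → ∀ (ℓ : ℕ) [Fact ℓ.Prime], ℓ ≠ 2 → ∀ (ι : PadicAlgCl ℓ ≃+* ℂ) (ρ : Literature.NumberTheory.GaloisRepresentations.FramedGaloisRep K (PadicAlgCl ℓ) n), ρ.toGaloisRep.IsIrreducible → ((∀ᶠ v : IsDedekindDomain.HeightOneSpectrum (NumberField.RingOfIntegers K) in cofinite, ρ.IsUnramifiedAt v) ∧ ∀ (v : IsDedekindDomain.HeightOneSpectrum (NumberField.RingOfIntegers K)) (hv : ((ℓ : ℕ) : NumberField.RingOfIntegers K) ∈ v.asIdeal), (Literature.NumberTheory.PAdicHodge.fontainePstAdicCompletion v ℓ hv).IsDeRhamFramed (ρ.toLocal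 v)) → (∀ (v : IsDedekindDomain.HeightOneSpectrum (NumberField.RingOfIntegers K)) (hv : ((ℓ : ℕ) : NumberField.RingOfIntegers K) ∈ v.asIdeal), (Literature.NumberTheory.PAdicHodge.fontainePstAdicCompletion v ℓ hv).IsCrystallineFramed (ρ.toLocal v)) → (∀ w : IsDedekindDomain.HeightOneSpectrum (NumberField.RingOfIntegers K), ((ℓ : ℕ) : NumberField.RingOfIntegers K) ∉ w.asIdeal → ρ.IsUnramifiedAt w) → ∀ (ι₂ : PadicAlgCl 2 ≃+* ℂ), ∃ ρ₂ : Literature.NumberTheory.GaloisRepresentations.FramedGaloisRep K (PadicAlgCl 2) n, ((∀ᶠ v : IsDedekindDomain.HeightOneSpectrum (NumberField.RingOfIntegers K) in cofinite, ρ₂.IsUnramifiedAt v) ∧ ∀ (v : IsDedekindDomain.HeightOneSpectrum (NumberField.RingOfIntegers K)) (hv : ((2 : ℕ) : NumberField.RingOfIntegers K) ∈ v.asIdeal), (Literature.NumberTheory.PAdicHodge.fontainePstAdicCompletion v 2 hv).IsDeRhamFramed (ρ₂.toLocal v)) ∧ (∀ᶠ v : IsDedekindDomain.HeightOneSpectrum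 (NumberField.RingOfIntegers K) in cofinite, ∃ α : Multiset ℂ, ρ.HasFrobCharpolyAt v (Literature.NumberTheory.Automorphic.arithFrobPolyOfSatake ι v.residueCard 1 α) ∧ ρ₂.HasFrobCharpolyAt v (Literature.NumberTheory.Automorphic.arithFrobPolyOfSatake ι₂ v.residueCard 1 α))

/-- [crux · WEAKER than the summit (`dyadicIrreducibilityTransfer_of_langlands`) and than C₂ (`dyadicIrreducibilityTransfer_of_companion`:
Chebotarev + Brauer–Nesbitt against the irreducible companion) · LEAF TAGS: ATTACKABLE NOW for n ≤ 2 (n = 1 is the kernel theorem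
`dyadicIrreducibilityTransfer_rank_one`; n = 2: a reducible pinned-geometric ρ₂ has de Rham — hence locally algebraic — 2-adic characters
as Jordan–Hölder constituents, class field theory + Weil give their ℓ-adic companions χ₁, χ₂, and ρ, χ₁ ⊕ χ₂ share Frobenius polynomials
a.e., contradicting `IrreducibleOffSector.isIrreducible_of_eventually_hasFrobCharpolyAt_common`; tree: `DeRhamLAdicCharacterHeckeReduction`)
· IDEA-NEEDED for n ≥ 3 (= ℓ-adic companions of the pinned-geometric CONSTITUENTS of ρ₂, ranks < n — an induction on n through E in
lower rank read from 2 to ℓ; irreducibility of the members of a compatible system at a FIXED prime is known in print only for a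
density-one set of primes on the regular polarizable sector, BLGGT §5.3 / Patrikis–Taylor 2015)]
I — DYADIC IRREDUCIBILITY TRANSFER: every pinned-geometric 2-adic ρ₂ matching (through (ι, ι₂)) an irreducible level-one crystalline
ℓ-adic ρ, ℓ odd, is irreducible.  Why strictly weaker than the summit: it is the irreducibility clause of (A) at the single prime 2
for companions of level-one crystalline ρ; no automorphy is asserted. -/
def DyadicIrreducibilityTransfer : Prop :=
  ∀ (K : Type) [Field K] [NumberField K] (n : ℕ), 0 < n → ∀ (ℓ : ℕ) [Fact ℓ.Prime], ℓ ≠ 2 → ∀ (ι : PadicAlgCl ℓ ≃+* ℂ) (ρ : Literature.NumberTheory.GaloisRepresentations.FramedGaloisRep K (PadicAlgCl ℓ) n), ρ.toGaloisRep.IsIrreducible → ((∀ᶠ v : IsDedekindDomain.HeightOneSpectrum (NumberField.RingOfIntegers K) in cofinite, ρ.IsUnramifiedAt v) ∧ ∀ (v : IsDedekindDomain.HeightOneSpectrum (NumberField.RingOfIntegers K)) (hv : ((ℓ : ℕ) : NumberField.RingOfIntegers K) ∈ v.asIdeal), (Literature.NumberTheory.PAdicHodge.fontainePstAdicCompletion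 v ℓ hv).IsDeRhamFramed (ρ.toLocal v)) → (∀ (v : IsDedekindDomain.HeightOneSpectrum (NumberField.RingOfIntegers K)) (hv : ((ℓ : ℕ) : NumberField.RingOfIntegers K) ∈ v.asIdeal), (Literature.NumberTheory.PAdicHodge.fontainePstAdicCompletion v ℓ hv).IsCrystallineFramed (ρ.toLocal v)) → (∀ w : IsDedekindDomain.HeightOneSpectrum (NumberField.RingOfIntegers K), ((ℓ : ℕ) : NumberField.RingOfIntegers K) ∉ w.asIdeal → ρ.IsUnramifiedAt w) → ∀ (ι₂ : PadicAlgCl 2 ≃+* ℂ), ∀ (ρ₂ : Literature.NumberTheory.GaloisRepresentations.FramedGaloisRep K (PadicAlgCl 2) n), ((∀ᶠ v : IsDedekindDomain.HeightOneSpectrum (NumberField.RingOfIntegers K) in cofinite, ρ₂.IsUnramifiedAt v) ∧ ∀ (v : IsDedekindDomain.HeightOneSpectrum (NumberField.RingOfIntegers K)) (hv : ((2 : ℕ) : NumberField.RingOfIntegers K) ∈ v.asIdeal), (Literature.NumberTheory.PAdicHodge.fontainePstAdicCompletion v 2 hv).IsDeRhamFramed (ρ₂.toLocal v)) → (∀ᶠ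 v : IsDedekindDomain.HeightOneSpectrum (NumberField.RingOfIntegers K) in cofinite, ∃ α : Multiset ℂ, ρ.HasFrobCharpolyAt v (Literature.NumberTheory.Automorphic.arithFrobPolyOfSatake ι v.residueCard 1 α) ∧ ρ₂.HasFrobCharpolyAt v (Literature.NumberTheory.Automorphic.arithFrobPolyOfSatake ι₂ v.residueCard 1 α)) → ρ₂.toGaloisRep.IsIrreducible

/-- [crux · WEAKER than the summit (`dyadicLevelTransfer_of_langlands`: (B) at ℓ, (A) at 2, LEVEL ONE READ BACK THROUGH π by the
Weil–Deligne chain `isUnramifiedAt_of_localGlobal_pair`, then Deligne–Serre conjugacy `exists_conj_of_match`) and than C₂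
(`dyadicLevelTransfer_of_companion`) · LEAF TAGS: ATTACKABLE NOW for n = 1 (class field theory: the λ-adic realisations of ONE algebraic
Hecke character have one conductor — Serre 1968 Ch. III §2; tree `DeRhamLAdicCharacterHeckeReduction`) and on every sector where ρ₂ (or
ρ) is known automorphic with local–global compatibility (the chain of this file is the proof) · IDEA-NEEDED in general = ℓ-INDEPENDENCE OF
THE CONDUCTOR inside a compatible pair of irreducible geometric representations (Fontaine's conjecture C_WD / Serre–Tate for abelian
varieties / Deligne for the cohomology of proper smooth varieties with good reduction; for an ABSTRACT compatible pair no proof is in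
print — searched: "independence of l conductor compatible system", "ramification compatible system unramified companion")]
U — DYADIC LEVEL TRANSFER: every IRREDUCIBLE pinned-geometric 2-adic ρ₂ matching a level-one crystalline ℓ-adic ρ (ℓ odd) through
(ι, ι₂) is unramified at every place not above 2.  Why strictly weaker than the summit: a ramification statement about Galois
representations only (no automorphy), for companions of level-one crystalline ρ only. -/
def DyadicLevelTransfer : Prop :=
  ∀ (K : Type) [Field K] [NumberField K] (n : ℕ), 0 < n → ∀ (ℓ : ℕ) [Fact ℓ.Prime], ℓ ≠ 2 → ∀ (ι : PadicAlgCl ℓ ≃+* ℂ) (ρ : Literature.NumberTheory.GaloisRepresentations.FramedGaloisRep K (PadicAlgCl ℓ) n), ρ.toGaloisRep.IsIrreducible → ((∀ᶠ v : IsDedekindDomain.HeightOneSpectrum (NumberField.RingOfIntegers K) in cofinite, ρ.IsUnramifiedAt v) ∧ ∀ (v : IsDedekindDomain.HeightOneSpectrum (NumberField.RingOfIntegers K)) (hv : ((ℓ : ℕ) : NumberField.RingOfIntegers K) ∈ v.asIdeal), (Literature.NumberTheory.PAdicHodge.fontainePstAdicCompletion v ℓ hv).IsDeRhamFramed (ρ.toLocal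 v)) → (∀ (v : IsDedekindDomain.HeightOneSpectrum (NumberField.RingOfIntegers K)) (hv : ((ℓ : ℕ) : NumberField.RingOfIntegers K) ∈ v.asIdeal), (Literature.NumberTheory.PAdicHodge.fontainePstAdicCompletion v ℓ hv).IsCrystallineFramed (ρ.toLocal v)) → (∀ w : IsDedekindDomain.HeightOneSpectrum (NumberField.RingOfIntegers K), ((ℓ : ℕ) : NumberField.RingOfIntegers K) ∉ w.asIdeal → ρ.IsUnramifiedAt w) → ∀ (ι₂ : PadicAlgCl 2 ≃+* ℂ), ∀ (ρ₂ : Literature.NumberTheory.GaloisRepresentations.FramedGaloisRep K (PadicAlgCl 2) n), ρ₂.toGaloisRep.IsIrreducible → ((∀ᶠ v : IsDedekindDomain.HeightOneSpectrum (NumberField.RingOfIntegers K) in cofinite, ρ₂.IsUnramifiedAt v) ∧ ∀ (v : IsDedekindDomain.HeightOneSpectrum (NumberField.RingOfIntegers K)) (hv : ((2 : ℕ) : NumberField.RingOfIntegers K) ∈ v.asIdeal), (Literature.NumberTheory.PAdicHodge.fontainePstAdicCompletion v 2 hv).IsDeRhamFramed (ρ₂.toLocal v)) → (∀ᶠ v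 : IsDedekindDomain.HeightOneSpectrum (NumberField.RingOfIntegers K) in cofinite, ∃ α : Multiset ℂ, ρ.HasFrobCharpolyAt v (Literature.NumberTheory.Automorphic.arithFrobPolyOfSatake ι v.residueCard 1 α) ∧ ρ₂.HasFrobCharpolyAt v (Literature.NumberTheory.Automorphic.arithFrobPolyOfSatake ι₂ v.residueCard 1 α)) → (∀ w : IsDedekindDomain.HeightOneSpectrum (NumberField.RingOfIntegers K), ((2 : ℕ) : NumberField.RingOfIntegers K) ∉ w.asIdeal → ρ₂.IsUnramifiedAt w)


end Dyadic

end Summit.Langlands.Langlands.Theorems.LevelOneDyadic
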